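import Literature.Analysis.FluidPDE.CaloricRemainderLocalEnergy
import HarnessLib

/-!
# Jia–Šverák 2014, proof of Thm. 3.1: the perturbed local energy inequality for `v = u - a`

Analysis/FluidPDE proofs file (theorems only, no new definitions, no new named facts), part of
the proof of the named fact `Literature.Analysis.FluidPDE.jia_sverak_2014_theorem_3_2`
(`JiaSverak2014LocalRegularity.lean`; H. Jia, V. Šverák, Invent. Math. 196 (2014) =
arXiv:1204.0529, §3 Thm. 3.2). In the printed proof of Thm. 3.1 (arXiv p. 8) the Leray solution
`u` near the initial time is compared with the regular (mild) flow `a` issued from the localised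
datum: "Let `v = u - a` […] `∂ₜv - Δv + a·∇v + div(v ⊗ v) + v·∇a + ∇q = 0`, `div v = 0` […].
Since `u` satisfies local energy inequality and `a` is regular in `ℝ³ × (0, T₁)` and
`lim_{t→0+} ‖a(·,t) - u₀‖_{L²_loc} = 0`, we can derive the local energy inequality for `v`". This
is the same computation as Lemarié-Rieusset's "three balances" in the proof of weak–strong
uniqueness for local Leray solutions (2016, Thm. 14.7, pp. 515–516), which the tree carries out
for Rusin–Šverák's *caloric* remainder (`CaloricRemainderLocalEnergy.lean`: the regular field
solves the heat equation). This file runs the tree's proof for a regular field solving a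
**forced** heat equation `∂ₜe = νΔe + g` — in the application `e = a`, `g = -(a·∇)a - ∇π`, a
classical Navier–Stokes flow — and expands the result into Jia–Šverák's form:

* `forcedCaloric_local_energy_identity` — `∫∫ |e|²φₜ + ν∫∫ |e|²Δφ + 2∫∫ φ⟪e, g⟫ = 2ν∫∫ |De|²φ`;
* `forced_remainder_local_energy_inequality` — the tree's
  `caloric_remainder_local_energy_inequality` with the extra term `-2∫∫ φ⟪w, g⟫`;
* `perturbed_local_energy_inequality` — for `(u, p)` distributional/suitable on an open
  `Ω ⊆ ℝ × E` and `(a, π)` smooth with `∂ₜa = νΔa - (a·∇)a - ∇π`, `div a = 0` on `Ω`: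
  `2ν ∫∫ |∇v|² φ ≤ ∫∫ |v|²(φₜ + νΔφ) + ∫∫ |v|² u·∇φ + 2 ∫∫ (p - π) v·∇φ - 2 ∫∫ φ ⟪Da(v), v⟫`
  for every `φ ∈ C_c^∞(Ω)`, `φ ≥ 0` (`v = u - a`, `∇v = G - Da`).

The proofs are the tree's (`CaloricRemainderCalculus.caloric_local_energy_identity`,
`caloric_remainder_local_energy_inequality`, and part (ii) of
`caloric_remainder_energy_inequality`), verbatim except for the bookkeeping of the forcing `g`.

## Mathlib / tree search

Tree: `caloric_local_energy_identity`, `caloric_remainder_local_energy_inequality`,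
`caloric_remainder_energy_inequality` (`∂ₜe = νΔe` only; `lean search 'remainder_local_energy|
perturbed.*energy|forced.*caloric'`); all tools of `CaloricRemainderCalculus.lean`,
`SuitableWeakPressure.lean`, `WholeSpaceIBP.lean` reused by name. Mathlib: `integral_prod`,
`integral_prod_symm`, `MemLp.mul'`.

## References

* H. Jia, V. Šverák, Invent. Math. 196 (2014) = arXiv:1204.0529, §3, proof of Thm. 3.1 (p. 8).
  Bib key `JiaSverak2014`.
* P. G. Lemarié-Rieusset, *The Navier–Stokes problem in the 21st century* (2016), Thm. 14.7,
  proof pp. 515–516. Bib key `LemarieRieusset2016`.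
* W. Rusin, V. Šverák, J. Funct. Anal. 260 (2011) = arXiv:0911.0500, §4 p. 6.
  Bib key `RusinSverak2011`.
* L. Caffarelli, R. Kohn, L. Nirenberg, Comm. Pure Appl. Math. 35 (1982), §2 (2.1)–(2.5).
  Bib key `CaffarelliKohnNirenberg1982`.
-/

noncomputable section

open MeasureTheory TopologicalSpace Set Function Filter InnerProductSpace
open _root_.Topology
open scoped RealInnerProductSpace ENNReal NNReal Laplacian

namespace Literature.Analysis.FluidPDE

variable {E : Type*} [NormedAddCommGroup E] [InnerProductSpace ℝ E] [FiniteDimensional ℝ E]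
  [MeasurableSpace E] [BorelSpace E]

namespace JiaSverak2014

/-! ### The forced heat flow -/

section Heat

variable {F' : Type*} [NormedAddCommGroup F'] [InnerProductSpace ℝ F'] [FiniteDimensional ℝ F']

/-- **The classical local energy identity of a forced heat flow.** Let `e : ℝ → E → F'` be
jointly smooth, solving `∂ₜe = νΔe + g` at every point of an open `Ω ⊆ ℝ × E` with a jointly
continuous forcing `g`, and let `φ ∈ C_c^∞(Ω)`. Then
`∫∫ |e|² ∂ₜφ + ν ∫∫ |e|² Δφ + 2 ∫∫ φ ⟪e, g⟫ = 2ν ∫∫ |De|² φ` (integrals over `ℝ × E`): the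
distributional form of `∂ₜ|e|² = νΔ|e|² - 2ν|∇e|² + 2⟪e, g⟫` (Lemarié-Rieusset 2016, proof of
Thm. 14.7, p. 515: the balance "`∂ₜ|u₁|²/2 = νΔ|u₁|²/2 - ν|∇u₁|² + u₁·(…)`" of the regular
solution; the tree's `caloric_local_energy_identity` is the case `g = 0`, whose proof this is,
with the extra pairing `∫∫ φ⟪e, g⟫` carried along the integration by parts in time).
[cite: LemarieRieusset2016, Thm. 14.7, proof p. 515] -/
theorem forcedCaloric_local_energy_identity {Ω : Opens (ℝ × E)} {ν : ℝ} {e g : ℝ → E → F'}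
    (he : ContDiff ℝ (⊤ : ℕ∞) (uncurry e)) (hg : Continuous (uncurry g))
    (hheat : ∀ z ∈ (Ω : Set (ℝ × E)),
      HasDerivAt (fun s => e s z.2) (ν • (Δ (e z.1)) z.2 + g z.1 z.2) z.1)
    {φ : ℝ → E → ℝ} (hφ : IsSpaceTimeTestOn Ω φ) :
    (∫ z : ℝ × E, ‖e z.1 z.2‖ ^ 2 * timeDeriv φ z.1 z.2) +
        ν * (∫ z : ℝ × E, ‖e z.1 z.2‖ ^ 2 * (Δ (φ z.1)) z.2) +
        2 * ∫ z : ℝ × E, φ z.1 z.2 * ⟪e z.1 z.2, g z.1 z.2⟫ =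
      2 * ν * ∫ z : ℝ × E, φ z.1 z.2 * frobeniusNormSq (fderiv ℝ (e z.1) z.2) := by
  set b := stdOrthonormalBasis ℝ E with hb
  -- ## smoothness and continuity
  have hes : IsSmoothSpaceTimeOn univ e := IsSmoothSpaceTimeOn.of_contDiff_univ he
  have hφs : IsSmoothSpaceTimeOn univ φ := hφ.isSmoothSpaceTimeOn univ
  have he_c : Continuous fun z : ℝ × E => e z.1 z.2 := hes.continuous_of_univ
  have hφ_c : Continuous fun z : ℝ × E => φ z.1 z.2 := hφs.continuous_of_univ
  have hlap_c : Continuous fun z : ℝ × E => (Δ (e z.1)) z.2 :=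
    (hes.laplacian uniqueDiffOn_univ).continuous_of_univ
  have hlapφ_c : Continuous fun z : ℝ × E => (Δ (φ z.1)) z.2 :=
    (hφs.laplacian uniqueDiffOn_univ).continuous_of_univ
  have hD_c : Continuous fun z : ℝ × E => fderiv ℝ (e z.1) z.2 :=
    (hes.fderiv_slice uniqueDiffOn_univ).continuous_of_univ
  have hgradφ_c : Continuous fun z : ℝ × E => gradient (φ z.1) z.2 :=
    (hφs.gradient uniqueDiffOn_univ).continuous_of_univ
  have hφt_c : Continuous fun z : ℝ × E => timeDeriv φ z.1 z.2 := hφ.continuous_timeDeriv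
  have hfrob_c : Continuous fun z : ℝ × E => frobeniusNormSq (fderiv ℝ (e z.1) z.2) := by
    have : (fun z : ℝ × E => frobeniusNormSq (fderiv ℝ (e z.1) z.2)) =
        fun z => ∑ i, ‖fderiv ℝ (e z.1) z.2 (b i)‖ ^ 2 := funext fun z => frobeniusNormSq_eq_sum b _
    rw [this]
    exact continuous_finsetSum _ fun i _ => ((hD_c.clm_apply continuous_const).norm).pow 2
  have he2 : ∀ t, ContDiff ℝ 2 (e t) := fun t => contDiff_infty.1 (contDiff_slice_field (F := F') he t) 2
  have he1 : ∀ t, ContDiff ℝ 1 (e t) := fun t => (he2 t).of_le one_le_two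
  have hφ2 : ∀ t, ContDiff ℝ 2 (φ t) := fun t => contDiff_infty.1 (hφ.contDiff_slice t) 2
  have hφc_slice : ∀ t, HasCompactSupport (φ t) := hφ.hasCompactSupport_slice
  -- ## the support
  set K : Set (ℝ × E) := tsupport (uncurry φ) with hK
  have hKc : IsCompact K := hφ.hasCompactSupport
  have hKΩ : K ⊆ (Ω : Set (ℝ × E)) := hφ.tsupport_subset
  have hφK : ∀ z : ℝ × E, z ∉ K → φ z.1 z.2 = 0 := fun z hz =>
    image_eq_zero_of_notMem_tsupport (f := uncurry φ) hz
  have hφtK : ∀ z : ℝ × E, z ∉ K → timeDeriv φ z.1 z.2 = 0 := fun z hz =>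
    IsSpaceTimeTestOn.timeDeriv_eq_zero_of_notMem hz
  have hnear : ∀ z : ℝ × E, z ∉ K → φ z.1 =ᶠ[𝓝 z.2] fun _ => (0 : ℝ) := fun z hz => by
    have h0 : uncurry φ =ᶠ[𝓝 (z.1, z.2)] 0 := notMem_tsupport_iff_eventuallyEq.1 hz
    have hc : Continuous fun y : E => (z.1, y) := continuous_const.prodMk continuous_id
    exact (hc.tendsto z.2).eventually h0
  have hlapK : ∀ z : ℝ × E, z ∉ K → (Δ (φ z.1)) z.2 = 0 := fun z hz => by
    rw [(InnerProductSpace.laplacian_congr_nhds (hnear z hz)).self_of_nhds,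
      InnerProductSpace.laplacian_const, Pi.zero_apply]
  -- compactly supported continuous integrands are integrable
  have hint : ∀ {f : ℝ × E → ℝ}, Continuous f → (∀ z ∉ K, f z = 0) → Integrable f volume :=
    fun hf h0 => hf.integrable_of_hasCompactSupport (HasCompactSupport.intro hKc h0)
  -- ## the heat equation on the support
  have hg_c : Continuous fun z : ℝ × E => g z.1 z.2 := hg
  have hderiv : ∀ z : ℝ × E, φ z.1 z.2 * ⟪e z.1 z.2, deriv (fun s => e s z.2) z.1⟫ =
      ν * (φ z.1 z.2 * ⟪e z.1 z.2, (Δ (e z.1)) z.2⟫) + φ z.1 z.2 * ⟪e z.1 z.2, g z.1 z.2⟫ := by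
    intro z
    by_cases hz : φ z.1 z.2 = 0
    · simp [hz]
    · have hzΩ : z ∈ (Ω : Set (ℝ × E)) := hKΩ (subset_tsupport _ (by exact hz))
      rw [(hheat z hzΩ).deriv, inner_add_right, inner_smul_right]
      ring
  -- ## Step 1: integration by parts in time, `∫∫ |e|² φₜ = -2ν ∫∫ φ ⟪e, Δe⟫`
  have hI_t : Integrable (fun z : ℝ × E => ‖e z.1 z.2‖ ^ 2 * timeDeriv φ z.1 z.2) volume :=
    hint ((he_c.norm.pow 2).mul hφt_c) fun z hz => by rw [hφtK z hz, mul_zero]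
  have hI_el : Integrable (fun z : ℝ × E => φ z.1 z.2 * ⟪e z.1 z.2, (Δ (e z.1)) z.2⟫) volume :=
    hint (hφ_c.mul (he_c.inner hlap_c)) fun z hz => by rw [hφK z hz, zero_mul]
  have hI_eg : Integrable (fun z : ℝ × E => φ z.1 z.2 * ⟪e z.1 z.2, g z.1 z.2⟫) volume :=
    hint (hφ_c.mul (he_c.inner hg_c)) fun z hz => by rw [hφK z hz, zero_mul]
  have hI_sum : Integrable (fun z : ℝ × E => ν * (φ z.1 z.2 * ⟪e z.1 z.2, (Δ (e z.1)) z.2⟫) +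
      φ z.1 z.2 * ⟪e z.1 z.2, g z.1 z.2⟫) volume := (hI_el.const_mul ν).add hI_eg
  have step1 : ∫ z : ℝ × E, ‖e z.1 z.2‖ ^ 2 * timeDeriv φ z.1 z.2 =
      -2 * ν * (∫ z : ℝ × E, φ z.1 z.2 * ⟪e z.1 z.2, (Δ (e z.1)) z.2⟫) -
        2 * ∫ z : ℝ × E, φ z.1 z.2 * ⟪e z.1 z.2, g z.1 z.2⟫ := by
    have hsum : -2 * ν * (∫ z : ℝ × E, φ z.1 z.2 * ⟪e z.1 z.2, (Δ (e z.1)) z.2⟫) -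
        2 * ∫ z : ℝ × E, φ z.1 z.2 * ⟪e z.1 z.2, g z.1 z.2⟫ =
        -2 * ∫ z : ℝ × E, (ν * (φ z.1 z.2 * ⟪e z.1 z.2, (Δ (e z.1)) z.2⟫) +
          φ z.1 z.2 * ⟪e z.1 z.2, g z.1 z.2⟫) := by
      rw [integral_add (hI_el.const_mul ν) hI_eg, integral_const_mul]
      ring
    rw [hsum, Measure.volume_eq_prod, integral_prod_symm _ hI_t, integral_prod_symm _ hI_sum,
      ← integral_const_mul]
    refine integral_congr_ae (Eventually.of_forall fun x => ?_)
    dsimp only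
    have h1 := integral_norm_sq_mul_deriv (e := fun s => e s x) (φ := fun s => φ s x)
      (contDiff_infty.1 (contDiff_timeLine_field he x) 1)
      (contDiff_infty.1 (contDiff_timeLine_field hφ.contDiff x) 1)
      (hasCompactSupport_timeLine hφ.hasCompactSupport x)
    have h2 : (fun s => ‖e s x‖ ^ 2 * timeDeriv φ s x) =
        fun s => ‖e s x‖ ^ 2 * deriv (fun s => φ s x) s :=
      funext fun s => by rw [timeDeriv_apply]
    have h3 : ∫ s, φ s x * ⟪e s x, deriv (fun s => e s x) s⟫ =
        ∫ s, (ν * (φ s x * ⟪e s x, (Δ (e s)) x⟫) + φ s x * ⟪e s x, g s x⟫) :=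
      integral_congr_ae (Eventually.of_forall fun s => hderiv (s, x))
    rw [h2, h1, h3]
  -- ## Step 2: Green's identity in space, slice by slice
  have hI_A : Integrable (fun z : ℝ × E => φ z.1 z.2 * frobeniusNormSq (fderiv ℝ (e z.1) z.2))
      volume :=
    hint (hφ_c.mul hfrob_c) fun z hz => by rw [hφK z hz, zero_mul]
  have hI_B : Integrable (fun z : ℝ × E => ‖e z.1 z.2‖ ^ 2 * (Δ (φ z.1)) z.2) volume :=
    hint ((he_c.norm.pow 2).mul hlapφ_c) fun z hz => by rw [hlapK z hz, mul_zero]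
  set A : ℝ → ℝ := fun t => ∫ x, φ t x * frobeniusNormSq (fderiv ℝ (e t) x) with hA
  set B : ℝ → ℝ := fun t => ∫ x, ‖e t x‖ ^ 2 * (Δ (φ t)) x with hB
  have hAint : Integrable A volume := hI_A.integral_prod_left
  have hBint : Integrable B volume := hI_B.integral_prod_left
  have hslice : ∀ t, ∫ x, φ t x * ⟪e t x, (Δ (e t)) x⟫ = -A t + (1 / 2 : ℝ) * B t := by
    intro t
    have h₁ := integral_mul_inner_laplacian_self (he2 t) (hφ2 t) (hφc_slice t)
    have h₂ := integral_inner_fderiv_gradient_self (he1 t) (hφ2 t) (hφc_slice t)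
    have hcomm : ∫ x, φ t x * ⟪e t x, (Δ (e t)) x⟫ = ∫ x, φ t x * ⟪(Δ (e t)) x, e t x⟫ :=
      integral_congr_ae (Eventually.of_forall fun x => by dsimp only; rw [real_inner_comm])
    rw [hcomm, h₁, h₂, hA, hB]
    ring
  have step2 : ∫ z : ℝ × E, φ z.1 z.2 * ⟪e z.1 z.2, (Δ (e z.1)) z.2⟫ =
      -(∫ z : ℝ × E, φ z.1 z.2 * frobeniusNormSq (fderiv ℝ (e z.1) z.2)) +
        (1 / 2 : ℝ) * ∫ z : ℝ × E, ‖e z.1 z.2‖ ^ 2 * (Δ (φ z.1)) z.2 := by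
    rw [Measure.volume_eq_prod, integral_prod _ hI_el, integral_prod _ hI_A, integral_prod _ hI_B]
    change ∫ t, ∫ x, φ t x * ⟪e t x, (Δ (e t)) x⟫ = -(∫ t, A t) + (1 / 2 : ℝ) * ∫ t, B t
    have hAneg : Integrable (fun t => -A t) volume := hAint.neg
    have hBmul : Integrable (fun t => (1 / 2 : ℝ) * B t) volume := hBint.const_mul _
    have hsum : ∫ t, (-A t + (1 / 2 : ℝ) * B t) = -(∫ t, A t) + (1 / 2 : ℝ) * ∫ t, B t := by
      rw [integral_add hAneg hBmul, integral_neg, integral_const_mul]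
    rw [← hsum]
    exact integral_congr_ae (Eventually.of_forall fun t => hslice t)
  -- ## conclusion
  rw [step1, step2]
  ring

end Heat

/-! ### The remainder of a suitable weak solution and a forced regular field -/

section Main

variable {Ω : Opens (ℝ × E)} {ν : ℝ} {u e : ℝ → E → E} {p : ℝ → E → ℝ}
  {G : ℝ → E → E →L[ℝ] E} {φ : ℝ → E → ℝ}

set_option maxHeartbeats 1600000 in
/-- **Local energy inequality of the remainder `w = u - e` for a forced regular field**
(Lemarié-Rieusset 2016, proof of Thm. 14.7, pp. 515–516, "the three balances for `|u₁|²/2`,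
`u₁·u₂`, `|u₂|²/2`" for a suitable solution `u₂` and a regular solution `u₁`; Jia–Šverák 2014,
proof of Thm. 3.1, arXiv:1204.0529 p. 8: "Since `u` satisfies local energy inequality and `a` is
regular […] we can derive the local energy inequality for `v`"). The tree's
`caloric_remainder_local_energy_inequality` (Rusin–Šverák's caloric remainder, `∂ₜe = νΔe`)
generalised to a smooth divergence-free field `e` with `∂ₜe = νΔe + g` on `Ω`, `g` jointly
continuous (for a classical Navier–Stokes flow `e = a`: `g = -(a·∇)a - ∇π`). Let `(u, p)` solve
the unforced Navier–Stokes equations in `𝒟'(Ω)` with a weak spatial gradient `G ∈ L²_loc(Ω)`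
satisfying the Caffarelli–Kohn–Nirenberg local energy inequality, `u ∈ L³_loc(Ω)`,
`p ∈ L^{3/2}_loc(Ω)`, and let `φ ∈ C_c^∞(Ω)`, `φ ≥ 0`. Then (iterated integrals, `∇w := G - De`,
`w := u - e`)
`2ν ∫∫ |∇w|² φ ≤ ∫∫ |w|²(φₜ + νΔφ) + ∫∫ (|w|² - |e|²) u·∇φ + 2 ∫∫ p w·∇φ - 2 ∫∫ φ ⟪De(u), u⟫
  - 2 ∫∫ φ ⟪w, g⟫`.
The proof is the tree's (the combination `(LEI) - 4ν(WG) - 2(NS) + (HEAT)`), with the momentum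
equation tested with `ψ = φe` now producing the extra pairing `∫∫ φ⟪u, g⟫` (through
`∂ₜψ = φₜ e + φ(νΔe + g)`) and the energy identity of `e` the extra `2∫∫ φ⟪e, g⟫`
(`forcedCaloric_local_energy_identity`). In this form the field `e` is only asked to be
divergence free ON `Ω` (`div e(t,·)(x) = 0` for `(t,x) ∈ Ω`), which is all the proof uses (the
divergence of the test field `φe` is only evaluated on `supp φ ⊆ Ω`); the globally divergence-free
version is `forced_remainder_local_energy_inequality` below.
[cite: LemarieRieusset2016, Thm. 14.7, proof pp. 515–516] [cite: JiaSverak2014, §3 proof of Thm. 3.1 (arXiv p. 8)] -/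
theorem forced_remainder_local_energy_inequality_localDiv {g : ℝ → E → E}
    (hNS : IsDistributionalNSSolutionOn Ω ν 0 u p)
    (hG : HasWeakSpatialGradientOn Ω u G)
    (hG2 : ∀ K ⊆ (Ω : Set (ℝ × E)), IsCompact K →
      ∫⁻ z in K, ENNReal.ofReal (frobeniusNormSq (G z.1 z.2)) < ∞)
    (hLEI : ∀ φ : ℝ → E → ℝ, IsSpaceTimeTestOn Ω φ → (∀ t x, 0 ≤ φ t x) →
      2 * ν * ∫ t, ∫ x, frobeniusNormSq (G t x) * φ t x ≤
        ∫ t, ∫ x, (‖u t x‖ ^ 2 * (timeDeriv φ t x + ν * Δ (φ t) x) +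
          (‖u t x‖ ^ 2 + 2 * p t x) * ⟪u t x, gradient (φ t) x⟫ +
          2 * ⟪(0 : ℝ → E → E) t x, u t x⟫ * φ t x))
    (hu3 : ∀ K ⊆ (Ω : Set (ℝ × E)), IsCompact K → MemLp (uncurry u) 3 (volume.restrict K))
    (hp32 : ∀ K ⊆ (Ω : Set (ℝ × E)), IsCompact K → MemLp (uncurry p) (3 / 2) (volume.restrict K))
    (he : ContDiff ℝ (⊤ : ℕ∞) (uncurry e)) (hg : Continuous (uncurry g))
    (hheat : ∀ z ∈ (Ω : Set (ℝ × E)),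
      HasDerivAt (fun s => e s z.2) (ν • (Δ (e z.1)) z.2 + g z.1 z.2) z.1)
    (hdiv : ∀ z ∈ (Ω : Set (ℝ × E)), VectorCalculus.divergence (e z.1) z.2 = 0)
    (hφ : IsSpaceTimeTestOn Ω φ) (hφ0 : ∀ t x, 0 ≤ φ t x) :
    2 * ν * ∫ t, ∫ x, frobeniusNormSq (G t x - fderiv ℝ (e t) x) * φ t x ≤
      (∫ t, ∫ x, ‖u t x - e t x‖ ^ 2 * (timeDeriv φ t x + ν * Δ (φ t) x)) +
        (∫ t, ∫ x, (‖u t x - e t x‖ ^ 2 - ‖e t x‖ ^ 2) * ⟪u t x, gradient (φ t) x⟫) +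
        2 * (∫ t, ∫ x, p t x * ⟪u t x - e t x, gradient (φ t) x⟫) -
        2 * (∫ t, ∫ x, φ t x * ⟪fderiv ℝ (e t) x (u t x), u t x⟫) -
        2 * ∫ t, ∫ x, φ t x * ⟪u t x - e t x, g t x⟫ := by
  haveI : (volume : Measure (ℝ × E)).IsAddHaarMeasure := Measure.prod.instIsAddHaarMeasure _ _
  haveI hHT31 : ENNReal.HolderTriple (3 / 2) 3 1 := by
    refine ⟨?_⟩
    rw [ENNReal.inv_div (Or.inr (by norm_num)) (Or.inr (by norm_num)), inv_one,
      show (3 : ℝ≥0∞)⁻¹ = 1 / 3 by rw [one_div], ENNReal.div_add_div_same,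
      show (2 : ℝ≥0∞) + 1 = 3 by norm_num, ENNReal.div_self (by norm_num) (by norm_num)]
  set b := stdOrthonormalBasis ℝ E with hb
  -- ### (0) smoothness and continuity of the weights
  have hes : IsSmoothSpaceTimeOn univ e := IsSmoothSpaceTimeOn.of_contDiff_univ he
  have hφs : IsSmoothSpaceTimeOn univ φ := hφ.isSmoothSpaceTimeOn univ
  have he_c : Continuous fun z : ℝ × E => e z.1 z.2 := hes.continuous_of_univ
  have hφ_c : Continuous fun z : ℝ × E => φ z.1 z.2 := hφs.continuous_of_univ
  have hLe_c : Continuous fun z : ℝ × E => (Δ (e z.1)) z.2 :=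
    (hes.laplacian uniqueDiffOn_univ).continuous_of_univ
  have hg_c : Continuous fun z : ℝ × E => g z.1 z.2 := hg
  have hLφ_c : Continuous fun z : ℝ × E => (Δ (φ z.1)) z.2 :=
    (hφs.laplacian uniqueDiffOn_univ).continuous_of_univ
  have hDes : IsSmoothSpaceTimeOn univ fun t x => fderiv ℝ (e t) x := hes.fderiv_slice uniqueDiffOn_univ
  have hDe_c : Continuous fun z : ℝ × E => fderiv ℝ (e z.1) z.2 := hDes.continuous_of_univ
  have hgφ_c : Continuous fun z : ℝ × E => gradient (φ z.1) z.2 :=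
    (hφs.gradient uniqueDiffOn_univ).continuous_of_univ
  have hφt_c : Continuous fun z : ℝ × E => timeDeriv φ z.1 z.2 := hφ.continuous_timeDeriv
  have hfrob_c : Continuous fun L : E →L[ℝ] E => frobeniusNormSq L := by
    have : (fun L : E →L[ℝ] E => frobeniusNormSq L) = fun L => ∑ i, ‖L (b i)‖ ^ 2 :=
      funext fun L => frobeniusNormSq_eq_sum b L
    rw [this]
    exact continuous_finsetSum _ fun i _ =>
      ((ContinuousLinearMap.apply ℝ E (b i)).continuous.norm).pow 2
  have he2 : ∀ t, ContDiff ℝ 2 (e t) := fun t => contDiff_infty.1 (contDiff_slice_field (F := E) he t) 2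
  have he1 : ∀ t, ContDiff ℝ 1 (e t) := fun t => (he2 t).of_le one_le_two
  have hed : ∀ t x, DifferentiableAt ℝ (e t) x := fun t x => (he1 t).differentiable one_ne_zero x
  have hφ2 : ∀ t, ContDiff ℝ 2 (φ t) := fun t => contDiff_infty.1 (hφ.contDiff_slice t) 2
  have hφd : ∀ t x, DifferentiableAt ℝ (φ t) x := fun t x =>
    ((hφ2 t).differentiable (by norm_num)) x
  -- ### (1) the support and the classes of `u`, `p`, `G` on it
  set K : Set (ℝ × E) := tsupport (uncurry φ) with hK
  have hKc : IsCompact K := hφ.hasCompactSupport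
  have hKΩ : K ⊆ (Ω : Set (ℝ × E)) := hφ.tsupport_subset
  have hKm : MeasurableSet K := hKc.measurableSet
  haveI hKfin : IsFiniteMeasure (volume.restrict K) := ⟨by
    rw [Measure.restrict_apply_univ]; exact hKc.measure_lt_top⟩
  have hφK : ∀ z : ℝ × E, z ∉ K → φ z.1 z.2 = 0 := fun z hz =>
    image_eq_zero_of_notMem_tsupport (f := uncurry φ) hz
  have hφtK : ∀ z : ℝ × E, z ∉ K → timeDeriv φ z.1 z.2 = 0 := fun z hz =>
    IsSpaceTimeTestOn.timeDeriv_eq_zero_of_notMem hz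
  have hnear : ∀ z : ℝ × E, z ∉ K → φ z.1 =ᶠ[𝓝 z.2] fun _ => (0 : ℝ) := fun z hz => by
    have h0 : uncurry φ =ᶠ[𝓝 (z.1, z.2)] 0 := notMem_tsupport_iff_eventuallyEq.1 hz
    have hc : Continuous fun y : E => (z.1, y) := continuous_const.prodMk continuous_id
    exact (hc.tendsto z.2).eventually h0
  have hgφK : ∀ z : ℝ × E, z ∉ K → gradient (φ z.1) z.2 = 0 := fun z hz => by
    rw [gradient, (hnear z hz).fderiv_eq, fderiv_fun_const, Pi.zero_apply, map_zero]
  have hLφK : ∀ z : ℝ × E, z ∉ K → (Δ (φ z.1)) z.2 = 0 := fun z hz => by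
    rw [(InnerProductSpace.laplacian_congr_nhds (hnear z hz)).self_of_nhds,
      InnerProductSpace.laplacian_const, Pi.zero_apply]
  -- the classes
  have huK : MemLp (uncurry u) 3 (volume.restrict K) := hu3 K hKΩ hKc
  have hpK : MemLp (uncurry p) (3 / 2) (volume.restrict K) := hp32 K hKΩ hKc
  have hum : AEStronglyMeasurable (uncurry u) (volume.restrict K) := huK.aestronglyMeasurable
  have hpm : AEStronglyMeasurable (uncurry p) (volume.restrict K) := hpK.aestronglyMeasurable
  have hGm : AEStronglyMeasurable (uncurry G) (volume.restrict K) :=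
    (hG.locallyIntegrableOn_grad.aestronglyMeasurable).mono_measure (Measure.restrict_mono hKΩ le_rfl)
  have hum' : AEStronglyMeasurable (fun z : ℝ × E => u z.1 z.2) (volume.restrict K) := hum
  have hpm' : AEStronglyMeasurable (fun z : ℝ × E => p z.1 z.2) (volume.restrict K) := hpm
  have hGm' : AEStronglyMeasurable (fun z : ℝ × E => G z.1 z.2) (volume.restrict K) := hGm
  have hu2K : MemLp (uncurry u) 2 (volume.restrict K) := huK.mono_exponent (by norm_num)
  -- integrable dominating functions on `K`
  have gU2 : IntegrableOn (fun z : ℝ × E => ‖u z.1 z.2‖ ^ 2) K volume :=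
    hu2K.integrable_norm_pow two_ne_zero
  have gU3 : IntegrableOn (fun z : ℝ × E => ‖u z.1 z.2‖ ^ 3) K volume :=
    huK.integrable_norm_pow (by norm_num)
  have gU1 : IntegrableOn (fun z : ℝ × E => ‖u z.1 z.2‖) K volume :=
    (huK.integrable (by norm_num)).norm
  have h1le32 : (1 : ℝ≥0∞) ≤ 3 / 2 := by
    rw [ENNReal.le_div_iff_mul_le (Or.inl (by norm_num)) (Or.inl (by norm_num))]
    norm_num
  have gP1 : IntegrableOn (fun z : ℝ × E => ‖p z.1 z.2‖) K volume :=
    (hpK.integrable h1le32).norm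
  have gPU : IntegrableOn (fun z : ℝ × E => ‖p z.1 z.2‖ * ‖u z.1 z.2‖) K volume := by
    have h := MemLp.mul' (r := 1) (f := fun z : ℝ × E => ‖u z.1 z.2‖)
      (φ := fun z : ℝ × E => ‖p z.1 z.2‖) huK.norm hpK.norm
    exact memLp_one_iff_integrable.1 h
  have gG2 : IntegrableOn (fun z : ℝ × E => frobeniusNormSq (G z.1 z.2)) K volume := by
    refine ⟨(hfrob_c.comp_aestronglyMeasurable hGm'), ?_⟩
    have hfin := hG2 K hKΩ hKc
    refine lt_of_le_of_lt (lintegral_mono fun z => ?_) hfin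
    rw [Real.enorm_eq_ofReal (frobeniusNormSq_nonneg _)]
  have gGi : ∀ i, IntegrableOn (fun z : ℝ × E => ‖G z.1 z.2 (b i)‖) K volume := by
    intro i
    have hmeas : AEStronglyMeasurable (fun z : ℝ × E => G z.1 z.2 (b i)) (volume.restrict K) :=
      (ContinuousLinearMap.apply ℝ E (b i)).continuous.comp_aestronglyMeasurable hGm'
    have h2 : MemLp (fun z : ℝ × E => G z.1 z.2 (b i)) 2 (volume.restrict K) := by
      refine (memLp_two_iff_integrable_sq_norm hmeas).2 ?_
      refine Integrable.mono' gG2 (hmeas.norm.pow 2) (Eventually.of_forall fun z => ?_)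
      rw [Real.norm_eq_abs, abs_of_nonneg (sq_nonneg _)]
      exact norm_apply_sq_le_frobeniusNormSq b _ i
    exact (h2.integrable one_le_two).norm
  -- bounds of the weights on `K`
  obtain ⟨Cφ, hCφ0, hCφ⟩ := exists_forall_mem_norm_le_of_continuous hKc hφ_c
  obtain ⟨Cφt, hCφt0, hCφt⟩ := exists_forall_mem_norm_le_of_continuous hKc hφt_c
  obtain ⟨CLφ, hCLφ0, hCLφ⟩ := exists_forall_mem_norm_le_of_continuous hKc hLφ_c
  obtain ⟨Cgφ, hCgφ0, hCgφ⟩ := exists_forall_mem_norm_le_of_continuous hKc hgφ_c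
  obtain ⟨Ce, hCe0, hCe⟩ := exists_forall_mem_norm_le_of_continuous hKc he_c
  obtain ⟨CDe, hCDe0, hCDe⟩ := exists_forall_mem_norm_le_of_continuous hKc hDe_c
  obtain ⟨CLe, hCLe0, hCLe⟩ := exists_forall_mem_norm_le_of_continuous hKc hLe_c
  obtain ⟨Cg, hCg0, hCg⟩ := exists_forall_mem_norm_le_of_continuous hKc hg_c
  -- ### (2) the integrands and their integrability
  -- (LEI) left-hand side and the four pieces of the right-hand side
  have iL : Integrable (fun z : ℝ × E => frobeniusNormSq (G z.1 z.2) * φ z.1 z.2) volume := by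
    refine integrable_of_bound_on_compact hKc (gG2.mul_const Cφ)
      ((hfrob_c.comp_aestronglyMeasurable hGm').mul hφ_c.aestronglyMeasurable)
      (fun z hz => by rw [hφK z hz, mul_zero]) fun z hz => ?_
    rw [norm_mul, Real.norm_eq_abs, abs_of_nonneg (frobeniusNormSq_nonneg _)]
    exact mul_le_mul_of_nonneg_left (hCφ z hz) (frobeniusNormSq_nonneg _)
  have iA1 : Integrable (fun z : ℝ × E => ‖u z.1 z.2‖ ^ 2 * timeDeriv φ z.1 z.2) volume := by
    refine integrable_of_bound_on_compact hKc (gU2.mul_const Cφt)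
      ((hum'.norm.pow 2).mul hφt_c.aestronglyMeasurable)
      (fun z hz => by rw [hφtK z hz, mul_zero]) fun z hz => ?_
    rw [norm_mul, Real.norm_eq_abs, abs_of_nonneg (sq_nonneg _)]
    exact mul_le_mul_of_nonneg_left (hCφt z hz) (sq_nonneg _)
  have iA2 : Integrable (fun z : ℝ × E => ‖u z.1 z.2‖ ^ 2 * (Δ (φ z.1)) z.2) volume := by
    refine integrable_of_bound_on_compact hKc (gU2.mul_const CLφ)
      ((hum'.norm.pow 2).mul hLφ_c.aestronglyMeasurable)
      (fun z hz => by rw [hLφK z hz, mul_zero]) fun z hz => ?_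
    rw [norm_mul, Real.norm_eq_abs, abs_of_nonneg (sq_nonneg _)]
    exact mul_le_mul_of_nonneg_left (hCLφ z hz) (sq_nonneg _)
  have iB1 : Integrable (fun z : ℝ × E => ‖u z.1 z.2‖ ^ 2 * ⟪u z.1 z.2, gradient (φ z.1) z.2⟫)
      volume := by
    refine integrable_of_bound_on_compact hKc (gU3.mul_const Cgφ)
      ((hum'.norm.pow 2).mul (hum'.inner hgφ_c.aestronglyMeasurable))
      (fun z hz => by rw [hgφK z hz, inner_zero_right, mul_zero]) fun z hz => ?_
    rw [norm_mul, Real.norm_eq_abs, abs_of_nonneg (sq_nonneg _)]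
    calc ‖u z.1 z.2‖ ^ 2 * ‖⟪u z.1 z.2, gradient (φ z.1) z.2⟫‖
        ≤ ‖u z.1 z.2‖ ^ 2 * (‖u z.1 z.2‖ * Cgφ) := by
          refine mul_le_mul_of_nonneg_left ?_ (sq_nonneg _)
          exact (norm_inner_le_norm _ _).trans (mul_le_mul_of_nonneg_left (hCgφ z hz) (norm_nonneg _))
      _ = ‖u z.1 z.2‖ ^ 3 * Cgφ := by ring
  have iB2 : Integrable (fun z : ℝ × E => p z.1 z.2 * ⟪u z.1 z.2, gradient (φ z.1) z.2⟫) volume := by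
    refine integrable_of_bound_on_compact hKc (gPU.mul_const Cgφ)
      (hpm'.mul (hum'.inner hgφ_c.aestronglyMeasurable))
      (fun z hz => by rw [hgφK z hz, inner_zero_right, mul_zero]) fun z hz => ?_
    rw [norm_mul]
    calc ‖p z.1 z.2‖ * ‖⟪u z.1 z.2, gradient (φ z.1) z.2⟫‖
        ≤ ‖p z.1 z.2‖ * (‖u z.1 z.2‖ * Cgφ) := by
          refine mul_le_mul_of_nonneg_left ?_ (norm_nonneg _)
          exact (norm_inner_le_norm _ _).trans (mul_le_mul_of_nonneg_left (hCgφ z hz) (norm_nonneg _))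
      _ = ‖p z.1 z.2‖ * ‖u z.1 z.2‖ * Cgφ := by ring
  -- (WG) the test functions `φ cᵢⱼ`, `cᵢⱼ = ⟪De(·) bᵢ, bⱼ⟫`
  set c : Fin (Module.finrank ℝ E) → Fin (Module.finrank ℝ E) → ℝ → E → ℝ :=
    fun i j t x => ⟪fderiv ℝ (e t) x (b i), b j⟫ with hc
  have hci : ∀ i, IsSmoothSpaceTimeOn univ fun t x => fderiv ℝ (e t) x (b i) := fun i =>
    hDes.clm_apply (v := fun _ _ => b i) contDiffOn_const
  have hc_smooth : ∀ i j, ContDiff ℝ ((⊤ : ℕ∞) : WithTop ℕ∞) (uncurry (c i j)) := by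
    intro i j
    have h1 : IsSmoothSpaceTimeOn univ (c i j) :=
      (hci i).inner (isSmoothSpaceTimeOn_const_time contDiff_const univ)
    rw [IsSmoothSpaceTimeOn, univ_prod_univ, contDiffOn_univ] at h1
    exact h1
  have hθ : ∀ i j, IsSpaceTimeTestOn Ω fun t x => φ t x * c i j t x := fun i j =>
    hφ.mul_smooth (hc_smooth i j)
  have hcd : ∀ i j t x, DifferentiableAt ℝ (c i j t) x := fun i j t x =>
    ((contDiff_slice_of_uncurry (hc_smooth i j) t).differentiable (by simp)) x
  -- second derivatives of `e` along `bᵢ`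
  have hdc : ∀ i j t x, fderiv ℝ (c i j t) x (b i) =
      ⟪fderiv ℝ (fun y => fderiv ℝ (e t) y (b i)) x (b i), b j⟫ := by
    intro i j t x
    have hd : DifferentiableAt ℝ (fun y => fderiv ℝ (e t) y (b i)) x :=
      (((he2 t).fderiv_right (m := 1) le_rfl).clm_apply contDiff_const).differentiable
        one_ne_zero x
    change fderiv ℝ (fun y => ⟪fderiv ℝ (e t) y (b i), b j⟫) x (b i) = _
    rw [fderiv_inner_apply ℝ hd (differentiableAt_const _)]
    simp
  -- the derivative of the test function `φ cᵢⱼ` along `bᵢ`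
  have hdθ : ∀ i j t x, fderiv ℝ (fun y => φ t y * c i j t y) x (b i) =
      fderiv ℝ (φ t) x (b i) * c i j t x +
        φ t x * ⟪fderiv ℝ (fun y => fderiv ℝ (e t) y (b i)) x (b i), b j⟫ := by
    intro i j t x
    rw [fderiv_fun_mul (hφd t x) (hcd i j t x)]
    simp only [_root_.add_apply, _root_.FunLike.coe_smul, Pi.smul_apply, smul_eq_mul, hdc]
    ring
  -- ### (3) the remaining integrands
  -- (WG) right-hand sides `(φ cᵢⱼ) ⟪G bᵢ, bⱼ⟫` and left-hand sides `∂ᵢ(φ cᵢⱼ) ⟪u, bⱼ⟫`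
  have iXij : ∀ i j, Integrable (fun z : ℝ × E =>
      (φ z.1 z.2 * c i j z.1 z.2) * ⟪G z.1 z.2 (b i), b j⟫) volume := by
    intro i j
    have hw_c : Continuous fun z : ℝ × E => φ z.1 z.2 * c i j z.1 z.2 :=
      (hθ i j).contDiff.continuous
    obtain ⟨Cw, hCw0, hCw⟩ := exists_forall_mem_norm_le_of_continuous hKc hw_c
    refine integrable_of_bound_on_compact hKc ((gGi i).const_mul Cw)
      (hw_c.aestronglyMeasurable.mul
        (((ContinuousLinearMap.apply ℝ E (b i)).continuous.comp_aestronglyMeasurable hGm').inner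
          aestronglyMeasurable_const))
      (fun z hz => by rw [hφK z hz, zero_mul, zero_mul]) fun z hz => ?_
    rw [norm_mul]
    have h2 : ‖⟪G z.1 z.2 (b i), b j⟫‖ ≤ ‖G z.1 z.2 (b i)‖ := by
      refine (norm_inner_le_norm _ _).trans ?_
      rw [b.orthonormal.1 j, mul_one]
    exact mul_le_mul (hCw z hz) h2 (norm_nonneg _) hCw0
  have iYij : ∀ i j, Integrable (fun z : ℝ × E =>
      fderiv ℝ (fun y => φ z.1 y * c i j z.1 y) z.2 (b i) * ⟪u z.1 z.2, b j⟫) volume := by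
    intro i j
    have hcont : Continuous fun z : ℝ × E => fderiv ℝ (fun y => φ z.1 y * c i j z.1 y) z.2 (b i) :=
      (((hθ i j).mono le_top).fderiv_apply_top (b i)).contDiff.continuous
    have hzero : ∀ z : ℝ × E, z ∉ K → fderiv ℝ (fun y => φ z.1 y * c i j z.1 y) z.2 (b i) = 0 := by
      intro z hz
      have hz' : z ∉ tsupport (uncurry fun t x => φ t x * c i j t x) := fun h =>
        hz (tsupport_mul_subset_left (f := uncurry φ) (g := uncurry (c i j)) h)
      have h0 := IsSpaceTimeTestOn.fderiv_slice_eq_zero_of_notMem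
        (ψ := fun t x => φ t x * c i j t x) hz'
      change fderiv ℝ (fun y => φ z.1 y * c i j z.1 y) z.2 (b i) = 0
      rw [h0, _root_.zero_apply]
    obtain ⟨Cw, hCw0, hCw⟩ := exists_forall_mem_norm_le_of_continuous hKc hcont
    refine integrable_of_bound_on_compact hKc (gU1.const_mul Cw)
      (hcont.aestronglyMeasurable.mul (hum'.inner aestronglyMeasurable_const))
      (fun z hz => by rw [hzero z hz, zero_mul]) fun z hz => ?_
    rw [norm_mul]
    have h2 : ‖⟪u z.1 z.2, b j⟫‖ ≤ ‖u z.1 z.2‖ := by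
      refine (norm_inner_le_norm _ _).trans ?_
      rw [b.orthonormal.1 j, mul_one]
    exact mul_le_mul (hCw z hz) h2 (norm_nonneg _) hCw0
  -- (WG)/(NS) the pairings `φ ⟪u, Δe⟫`, `⟪u, De(∇φ)⟫`
  have iM1 : Integrable (fun z : ℝ × E => φ z.1 z.2 * ⟪u z.1 z.2, (Δ (e z.1)) z.2⟫) volume := by
    refine integrable_of_bound_on_compact hKc (gU1.const_mul (Cφ * CLe))
      (hφ_c.aestronglyMeasurable.mul (hum'.inner hLe_c.aestronglyMeasurable))
      (fun z hz => by rw [hφK z hz, zero_mul]) fun z hz => ?_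
    rw [norm_mul]
    calc ‖φ z.1 z.2‖ * ‖⟪u z.1 z.2, (Δ (e z.1)) z.2⟫‖
        ≤ Cφ * (‖u z.1 z.2‖ * CLe) :=
          mul_le_mul (hCφ z hz) ((norm_inner_le_norm _ _).trans
            (mul_le_mul_of_nonneg_left (hCLe z hz) (norm_nonneg _))) (norm_nonneg _) hCφ0
      _ = Cφ * CLe * ‖u z.1 z.2‖ := by ring
  have iM2 : Integrable (fun z : ℝ × E =>
      ⟪u z.1 z.2, fderiv ℝ (e z.1) z.2 (gradient (φ z.1) z.2)⟫) volume := by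
    refine integrable_of_bound_on_compact hKc (gU1.const_mul (CDe * Cgφ))
      (hum'.inner (hDe_c.clm_apply hgφ_c).aestronglyMeasurable)
      (fun z hz => by rw [hgφK z hz, map_zero, inner_zero_right]) fun z hz => ?_
    calc ‖⟪u z.1 z.2, fderiv ℝ (e z.1) z.2 (gradient (φ z.1) z.2)⟫‖
        ≤ ‖u z.1 z.2‖ * (CDe * Cgφ) := (norm_inner_le_norm _ _).trans
            (mul_le_mul_of_nonneg_left ((ContinuousLinearMap.le_opNorm _ _).trans
              (mul_le_mul (hCDe z hz) (hCgφ z hz) (norm_nonneg _) hCDe0)) (norm_nonneg _))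
      _ = CDe * Cgφ * ‖u z.1 z.2‖ := by ring
  -- (NS) the pairings `φₜ ⟪u, e⟫`, `⟪u, ∇φ⟫⟪u, e⟫`, `φ ⟪De(u), u⟫`, `Δφ ⟪u, e⟫`, `p ⟪e, ∇φ⟫`
  have iP1 : Integrable (fun z : ℝ × E => timeDeriv φ z.1 z.2 * ⟪u z.1 z.2, e z.1 z.2⟫) volume := by
    refine integrable_of_bound_on_compact hKc (gU1.const_mul (Cφt * Ce))
      (hφt_c.aestronglyMeasurable.mul (hum'.inner he_c.aestronglyMeasurable))
      (fun z hz => by rw [hφtK z hz, zero_mul]) fun z hz => ?_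
    rw [norm_mul]
    calc ‖timeDeriv φ z.1 z.2‖ * ‖⟪u z.1 z.2, e z.1 z.2⟫‖ ≤ Cφt * (‖u z.1 z.2‖ * Ce) :=
          mul_le_mul (hCφt z hz) ((norm_inner_le_norm _ _).trans
            (mul_le_mul_of_nonneg_left (hCe z hz) (norm_nonneg _))) (norm_nonneg _) hCφt0
      _ = Cφt * Ce * ‖u z.1 z.2‖ := by ring
  have iP2 : Integrable (fun z : ℝ × E =>
      ⟪u z.1 z.2, gradient (φ z.1) z.2⟫ * ⟪u z.1 z.2, e z.1 z.2⟫) volume := by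
    refine integrable_of_bound_on_compact hKc (gU2.const_mul (Cgφ * Ce))
      ((hum'.inner hgφ_c.aestronglyMeasurable).mul (hum'.inner he_c.aestronglyMeasurable))
      (fun z hz => by rw [hgφK z hz, inner_zero_right, zero_mul]) fun z hz => ?_
    rw [norm_mul]
    calc ‖⟪u z.1 z.2, gradient (φ z.1) z.2⟫‖ * ‖⟪u z.1 z.2, e z.1 z.2⟫‖
        ≤ (‖u z.1 z.2‖ * Cgφ) * (‖u z.1 z.2‖ * Ce) :=
          mul_le_mul ((norm_inner_le_norm _ _).trans (mul_le_mul_of_nonneg_left (hCgφ z hz)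
            (norm_nonneg _))) ((norm_inner_le_norm _ _).trans (mul_le_mul_of_nonneg_left (hCe z hz)
            (norm_nonneg _))) (norm_nonneg _) (by positivity)
      _ = Cgφ * Ce * ‖u z.1 z.2‖ ^ 2 := by ring
  have hDeu : AEStronglyMeasurable (fun z : ℝ × E => fderiv ℝ (e z.1) z.2 (u z.1 z.2))
      (volume.restrict K) :=
    (isBoundedBilinearMap_apply (𝕜 := ℝ) (E := E) (F := E)).continuous.comp_aestronglyMeasurable₂
      hDe_c.aestronglyMeasurable hum'
  have iP3 : Integrable (fun z : ℝ × E =>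
      φ z.1 z.2 * ⟪fderiv ℝ (e z.1) z.2 (u z.1 z.2), u z.1 z.2⟫) volume := by
    refine integrable_of_bound_on_compact hKc (gU2.const_mul (Cφ * CDe))
      (hφ_c.aestronglyMeasurable.mul (hDeu.inner hum'))
      (fun z hz => by rw [hφK z hz, zero_mul]) fun z hz => ?_
    rw [norm_mul]
    calc ‖φ z.1 z.2‖ * ‖⟪fderiv ℝ (e z.1) z.2 (u z.1 z.2), u z.1 z.2⟫‖
        ≤ Cφ * ((CDe * ‖u z.1 z.2‖) * ‖u z.1 z.2‖) :=
          mul_le_mul (hCφ z hz) ((norm_inner_le_norm _ _).trans (mul_le_mul_of_nonneg_right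
            ((ContinuousLinearMap.le_opNorm _ _).trans (mul_le_mul_of_nonneg_right (hCDe z hz)
            (norm_nonneg _))) (norm_nonneg _))) (norm_nonneg _) hCφ0
      _ = Cφ * CDe * ‖u z.1 z.2‖ ^ 2 := by ring
  have iP4 : Integrable (fun z : ℝ × E => (Δ (φ z.1)) z.2 * ⟪u z.1 z.2, e z.1 z.2⟫) volume := by
    refine integrable_of_bound_on_compact hKc (gU1.const_mul (CLφ * Ce))
      (hLφ_c.aestronglyMeasurable.mul (hum'.inner he_c.aestronglyMeasurable))
      (fun z hz => by rw [hLφK z hz, zero_mul]) fun z hz => ?_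
    rw [norm_mul]
    calc ‖(Δ (φ z.1)) z.2‖ * ‖⟪u z.1 z.2, e z.1 z.2⟫‖ ≤ CLφ * (‖u z.1 z.2‖ * Ce) :=
          mul_le_mul (hCLφ z hz) ((norm_inner_le_norm _ _).trans
            (mul_le_mul_of_nonneg_left (hCe z hz) (norm_nonneg _))) (norm_nonneg _) hCLφ0
      _ = CLφ * Ce * ‖u z.1 z.2‖ := by ring
  have iP5 : Integrable (fun z : ℝ × E => p z.1 z.2 * ⟪e z.1 z.2, gradient (φ z.1) z.2⟫) volume := by
    refine integrable_of_bound_on_compact hKc (gP1.mul_const (Ce * Cgφ))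
      (hpm'.mul (he_c.inner hgφ_c).aestronglyMeasurable)
      (fun z hz => by rw [hgφK z hz, inner_zero_right, mul_zero]) fun z hz => ?_
    rw [norm_mul]
    exact mul_le_mul_of_nonneg_left ((norm_inner_le_norm _ _).trans
      (mul_le_mul (hCe z hz) (hCgφ z hz) (norm_nonneg _) hCe0)) (norm_nonneg _)
  -- (forcing) the pairing `φ ⟪u, g⟫`
  have iP6 : Integrable (fun z : ℝ × E => φ z.1 z.2 * ⟪u z.1 z.2, g z.1 z.2⟫) volume := by
    refine integrable_of_bound_on_compact hKc (gU1.const_mul (Cφ * Cg))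
      (hφ_c.aestronglyMeasurable.mul (hum'.inner hg_c.aestronglyMeasurable))
      (fun z hz => by rw [hφK z hz, zero_mul]) fun z hz => ?_
    rw [norm_mul]
    calc ‖φ z.1 z.2‖ * ‖⟪u z.1 z.2, g z.1 z.2⟫‖
        ≤ Cφ * (‖u z.1 z.2‖ * Cg) :=
          mul_le_mul (hCφ z hz) ((norm_inner_le_norm _ _).trans
            (mul_le_mul_of_nonneg_left (hCg z hz) (norm_nonneg _))) (norm_nonneg _) hCφ0
      _ = Cφ * Cg * ‖u z.1 z.2‖ := by ring
  -- (HEAT)/(expansions) the smooth integrands `|e|² φₜ`, `|e|² Δφ`, `φ |De|²`, `φ ⟪G, De⟫_F`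
  have hint : ∀ {f : ℝ × E → ℝ}, Continuous f → (∀ z ∉ K, f z = 0) → Integrable f volume :=
    fun hf h0 => hf.integrable_of_hasCompactSupport (HasCompactSupport.intro hKc h0)
  have iHg : Integrable (fun z : ℝ × E => φ z.1 z.2 * ⟪e z.1 z.2, g z.1 z.2⟫) volume :=
    hint (hφ_c.mul (he_c.inner hg_c)) fun z hz => by rw [hφK z hz, zero_mul]
  have iH1 : Integrable (fun z : ℝ × E => ‖e z.1 z.2‖ ^ 2 * timeDeriv φ z.1 z.2) volume :=
    hint ((he_c.norm.pow 2).mul hφt_c) fun z hz => by rw [hφtK z hz, mul_zero]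
  have iH2 : Integrable (fun z : ℝ × E => ‖e z.1 z.2‖ ^ 2 * (Δ (φ z.1)) z.2) volume :=
    hint ((he_c.norm.pow 2).mul hLφ_c) fun z hz => by rw [hLφK z hz, mul_zero]
  have iN : Integrable (fun z : ℝ × E => φ z.1 z.2 * frobeniusNormSq (fderiv ℝ (e z.1) z.2)) volume :=
    hint (hφ_c.mul (hfrob_c.comp hDe_c)) fun z hz => by rw [hφK z hz, zero_mul]
  have iFI : Integrable (fun z : ℝ × E =>
      φ z.1 z.2 * ∑ i, ⟪G z.1 z.2 (b i), fderiv ℝ (e z.1) z.2 (b i)⟫) volume := by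
    have h1 : ∀ i, Integrable (fun z : ℝ × E =>
        φ z.1 z.2 * ⟪G z.1 z.2 (b i), fderiv ℝ (e z.1) z.2 (b i)⟫) volume := by
      intro i
      refine integrable_of_bound_on_compact hKc ((gGi i).const_mul (Cφ * CDe))
        (hφ_c.aestronglyMeasurable.mul
          (((ContinuousLinearMap.apply ℝ E (b i)).continuous.comp_aestronglyMeasurable hGm').inner
            (hDe_c.clm_apply continuous_const).aestronglyMeasurable))
        (fun z hz => by rw [hφK z hz, zero_mul]) fun z hz => ?_
      rw [norm_mul]
      have h3 : ‖fderiv ℝ (e z.1) z.2 (b i)‖ ≤ CDe :=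
        (ContinuousLinearMap.le_opNorm _ _).trans (by rw [b.orthonormal.1 i, mul_one]; exact hCDe z hz)
      calc ‖φ z.1 z.2‖ * ‖⟪G z.1 z.2 (b i), fderiv ℝ (e z.1) z.2 (b i)⟫‖
          ≤ Cφ * (‖G z.1 z.2 (b i)‖ * CDe) :=
            mul_le_mul (hCφ z hz) ((norm_inner_le_norm _ _).trans
              (mul_le_mul_of_nonneg_left h3 (norm_nonneg _))) (norm_nonneg _) hCφ0
        _ = Cφ * CDe * ‖G z.1 z.2 (b i)‖ := by ring
    have h2 : Integrable (fun z : ℝ × E => ∑ i, φ z.1 z.2 * ⟪G z.1 z.2 (b i), fderiv ℝ (e z.1) z.2 (b i)⟫)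
        volume := integrable_finsetSum Finset.univ fun i _ => h1 i
    refine h2.congr (Eventually.of_forall fun z => ?_)
    simp only [Finset.mul_sum]
  -- ### (4) the four inputs as identities between real numbers
  -- names for the integrals
  set L : ℝ := ∫ z : ℝ × E, frobeniusNormSq (G z.1 z.2) * φ z.1 z.2 with hL
  set A1 : ℝ := ∫ z : ℝ × E, ‖u z.1 z.2‖ ^ 2 * timeDeriv φ z.1 z.2 with hA1
  set A2 : ℝ := ∫ z : ℝ × E, ‖u z.1 z.2‖ ^ 2 * (Δ (φ z.1)) z.2 with hA2
  set B1 : ℝ := ∫ z : ℝ × E, ‖u z.1 z.2‖ ^ 2 * ⟪u z.1 z.2, gradient (φ z.1) z.2⟫ with hB1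
  set B2 : ℝ := ∫ z : ℝ × E, p z.1 z.2 * ⟪u z.1 z.2, gradient (φ z.1) z.2⟫ with hB2
  set X1 : ℝ := ∫ z : ℝ × E, φ z.1 z.2 * ∑ i, ⟪G z.1 z.2 (b i), fderiv ℝ (e z.1) z.2 (b i)⟫ with hX1
  set M1 : ℝ := ∫ z : ℝ × E, φ z.1 z.2 * ⟪u z.1 z.2, (Δ (e z.1)) z.2⟫ with hM1
  set M2 : ℝ := ∫ z : ℝ × E, ⟪u z.1 z.2, fderiv ℝ (e z.1) z.2 (gradient (φ z.1) z.2)⟫ with hM2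
  set P1 : ℝ := ∫ z : ℝ × E, timeDeriv φ z.1 z.2 * ⟪u z.1 z.2, e z.1 z.2⟫ with hP1
  set P2 : ℝ := ∫ z : ℝ × E, ⟪u z.1 z.2, gradient (φ z.1) z.2⟫ * ⟪u z.1 z.2, e z.1 z.2⟫ with hP2
  set P3 : ℝ := ∫ z : ℝ × E, φ z.1 z.2 * ⟪fderiv ℝ (e z.1) z.2 (u z.1 z.2), u z.1 z.2⟫ with hP3
  set P4 : ℝ := ∫ z : ℝ × E, (Δ (φ z.1)) z.2 * ⟪u z.1 z.2, e z.1 z.2⟫ with hP4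
  set P5 : ℝ := ∫ z : ℝ × E, p z.1 z.2 * ⟪e z.1 z.2, gradient (φ z.1) z.2⟫ with hP5
  set P6 : ℝ := ∫ z : ℝ × E, φ z.1 z.2 * ⟪u z.1 z.2, g z.1 z.2⟫ with hP6
  set Hg : ℝ := ∫ z : ℝ × E, φ z.1 z.2 * ⟪e z.1 z.2, g z.1 z.2⟫ with hHg
  set H1 : ℝ := ∫ z : ℝ × E, ‖e z.1 z.2‖ ^ 2 * timeDeriv φ z.1 z.2 with hH1
  set H2 : ℝ := ∫ z : ℝ × E, ‖e z.1 z.2‖ ^ 2 * (Δ (φ z.1)) z.2 with hH2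
  set N : ℝ := ∫ z : ℝ × E, φ z.1 z.2 * frobeniusNormSq (fderiv ℝ (e z.1) z.2) with hN
  -- (LEI)
  have hLEI' : 2 * ν * L ≤ A1 + ν * A2 + B1 + 2 * B2 := by
    have hle := hLEI φ hφ hφ0
    have iA2' : Integrable (fun z : ℝ × E => ν * (‖u z.1 z.2‖ ^ 2 * (Δ (φ z.1)) z.2)) volume :=
      iA2.const_mul ν
    have iB2' : Integrable (fun z : ℝ × E => 2 * (p z.1 z.2 * ⟪u z.1 z.2, gradient (φ z.1) z.2⟫))
        volume := iB2.const_mul 2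
    have iB12 : Integrable (fun z : ℝ × E => ‖u z.1 z.2‖ ^ 2 * ⟪u z.1 z.2, gradient (φ z.1) z.2⟫ +
        2 * (p z.1 z.2 * ⟪u z.1 z.2, gradient (φ z.1) z.2⟫)) volume := iB1.add iB2'
    have iAB : Integrable (fun z : ℝ × E => ν * (‖u z.1 z.2‖ ^ 2 * (Δ (φ z.1)) z.2) +
        (‖u z.1 z.2‖ ^ 2 * ⟪u z.1 z.2, gradient (φ z.1) z.2⟫ +
          2 * (p z.1 z.2 * ⟪u z.1 z.2, gradient (φ z.1) z.2⟫))) volume := iA2'.add iB12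
    have iR : Integrable (fun z : ℝ × E => ‖u z.1 z.2‖ ^ 2 * (timeDeriv φ z.1 z.2 + ν * Δ (φ z.1) z.2) +
        (‖u z.1 z.2‖ ^ 2 + 2 * p z.1 z.2) * ⟪u z.1 z.2, gradient (φ z.1) z.2⟫ +
        2 * ⟪(0 : ℝ → E → E) z.1 z.2, u z.1 z.2⟫ * φ z.1 z.2) volume := by
      refine (iA1.add iAB).congr (Eventually.of_forall fun z => ?_)
      simp only [Pi.add_apply, Pi.zero_apply, inner_zero_left, mul_zero, zero_mul, add_zero]
      ring
    have h1 : ∫ t, ∫ x, frobeniusNormSq (G t x) * φ t x = L :=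
      (integral_prod (μ := volume) (ν := volume) _ iL).symm
    have h2 : ∫ t, ∫ x, (‖u t x‖ ^ 2 * (timeDeriv φ t x + ν * Δ (φ t) x) +
        (‖u t x‖ ^ 2 + 2 * p t x) * ⟪u t x, gradient (φ t) x⟫ +
        2 * ⟪(0 : ℝ → E → E) t x, u t x⟫ * φ t x) = A1 + ν * A2 + B1 + 2 * B2 := by
      rw [← integral_prod (μ := volume) (ν := volume) _ iR]
      change ∫ z : ℝ × E, (‖u z.1 z.2‖ ^ 2 * (timeDeriv φ z.1 z.2 + ν * Δ (φ z.1) z.2) +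
        (‖u z.1 z.2‖ ^ 2 + 2 * p z.1 z.2) * ⟪u z.1 z.2, gradient (φ z.1) z.2⟫ +
        2 * ⟪(0 : ℝ → E → E) z.1 z.2, u z.1 z.2⟫ * φ z.1 z.2) = A1 + ν * A2 + B1 + 2 * B2
      have e1 : (fun z : ℝ × E => ‖u z.1 z.2‖ ^ 2 * (timeDeriv φ z.1 z.2 + ν * Δ (φ z.1) z.2) +
          (‖u z.1 z.2‖ ^ 2 + 2 * p z.1 z.2) * ⟪u z.1 z.2, gradient (φ z.1) z.2⟫ +
          2 * ⟪(0 : ℝ → E → E) z.1 z.2, u z.1 z.2⟫ * φ z.1 z.2) =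
          fun z : ℝ × E => ‖u z.1 z.2‖ ^ 2 * timeDeriv φ z.1 z.2 +
            (ν * (‖u z.1 z.2‖ ^ 2 * (Δ (φ z.1)) z.2) +
              (‖u z.1 z.2‖ ^ 2 * ⟪u z.1 z.2, gradient (φ z.1) z.2⟫ +
                2 * (p z.1 z.2 * ⟪u z.1 z.2, gradient (φ z.1) z.2⟫))) := by
        funext z
        simp only [Pi.zero_apply, inner_zero_left, mul_zero, zero_mul, add_zero]
        ring
      rw [e1, integral_add iA1 iAB, integral_add iA2' iB12, integral_add iB1 iB2', integral_const_mul,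
        integral_const_mul, hA1, hA2, hB1, hB2]
      ring
    rw [h1, h2] at hle
    exact hle
  -- (HEAT)
  have hHeat : H1 + ν * H2 + 2 * Hg = 2 * ν * N := forcedCaloric_local_energy_identity he hg hheat hφ
  -- (WG)
  have hWG : X1 = -(M1 + M2) := by
    -- entry-wise identities, in product form
    have hij : ∀ i j, ∫ z : ℝ × E, fderiv ℝ (fun y => φ z.1 y * c i j z.1 y) z.2 (b i) *
        ⟪u z.1 z.2, b j⟫ = -∫ z : ℝ × E, (φ z.1 z.2 * c i j z.1 z.2) * ⟪G z.1 z.2 (b i), b j⟫ := by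
      intro i j
      have h := hG.integral_fderiv_mul_inner_eq (fun t x => φ t x * c i j t x) (hθ i j) (b i) (b j)
      have h1 := integral_prod (μ := volume) (ν := volume) _ (iYij i j)
      have h2 := integral_prod (μ := volume) (ν := volume) _ (iXij i j)
      rw [← Measure.volume_eq_prod] at h1 h2
      rw [h1, h2]
      exact h
    -- sum over `i`, `j`
    have hsumY : ∫ z : ℝ × E, ∑ i, ∑ j, fderiv ℝ (fun y => φ z.1 y * c i j z.1 y) z.2 (b i) *
        ⟪u z.1 z.2, b j⟫ = -∫ z : ℝ × E, ∑ i, ∑ j, (φ z.1 z.2 * c i j z.1 z.2) * ⟪G z.1 z.2 (b i), b j⟫ := by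
      have iYi : ∀ i, Integrable (fun z : ℝ × E => ∑ j, fderiv ℝ (fun y => φ z.1 y * c i j z.1 y) z.2 (b i) *
          ⟪u z.1 z.2, b j⟫) volume := fun i => integrable_finsetSum _ fun j _ => iYij i j
      have iXi : ∀ i, Integrable (fun z : ℝ × E => ∑ j, (φ z.1 z.2 * c i j z.1 z.2) *
          ⟪G z.1 z.2 (b i), b j⟫) volume := fun i => integrable_finsetSum _ fun j _ => iXij i j
      rw [integral_finsetSum _ fun i _ => iYi i, integral_finsetSum _ fun i _ => iXi i,
        ← Finset.sum_neg_distrib]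
      refine Finset.sum_congr rfl fun i _ => ?_
      rw [integral_finsetSum _ fun j _ => iYij i j, integral_finsetSum _ fun j _ => iXij i j,
        ← Finset.sum_neg_distrib]
      exact Finset.sum_congr rfl fun j _ => hij i j
    -- pointwise evaluation of the sums
    have hYsum : ∀ z : ℝ × E, ∑ i, ∑ j, fderiv ℝ (fun y => φ z.1 y * c i j z.1 y) z.2 (b i) *
        ⟪u z.1 z.2, b j⟫ = ⟪u z.1 z.2, fderiv ℝ (e z.1) z.2 (gradient (φ z.1) z.2)⟫ +
          φ z.1 z.2 * ⟪u z.1 z.2, (Δ (e z.1)) z.2⟫ := by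
      intro z
      have hA : ∀ i, ∑ j, c i j z.1 z.2 * ⟪u z.1 z.2, b j⟫ = ⟪fderiv ℝ (e z.1) z.2 (b i), u z.1 z.2⟫ := by
        intro i
        rw [← b.sum_inner_mul_inner (fderiv ℝ (e z.1) z.2 (b i)) (u z.1 z.2)]
        refine Finset.sum_congr rfl fun j _ => ?_
        simp only [hc, real_inner_comm (b j) (u z.1 z.2)]
      have hB : ∀ i, ∑ j, ⟪fderiv ℝ (fun y => fderiv ℝ (e z.1) y (b i)) z.2 (b i), b j⟫ *
          ⟪u z.1 z.2, b j⟫ = ⟪fderiv ℝ (fun y => fderiv ℝ (e z.1) y (b i)) z.2 (b i), u z.1 z.2⟫ := by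
        intro i
        rw [← b.sum_inner_mul_inner (fderiv ℝ (fun y => fderiv ℝ (e z.1) y (b i)) z.2 (b i)) (u z.1 z.2)]
        refine Finset.sum_congr rfl fun j _ => ?_
        rw [real_inner_comm (b j) (u z.1 z.2)]
      have h1 : ∀ i, ∑ j, fderiv ℝ (fun y => φ z.1 y * c i j z.1 y) z.2 (b i) * ⟪u z.1 z.2, b j⟫ =
          fderiv ℝ (φ z.1) z.2 (b i) * ⟪fderiv ℝ (e z.1) z.2 (b i), u z.1 z.2⟫ +
            φ z.1 z.2 * ⟪fderiv ℝ (fun y => fderiv ℝ (e z.1) y (b i)) z.2 (b i), u z.1 z.2⟫ := by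
        intro i
        rw [← hA i, ← hB i, Finset.mul_sum, Finset.mul_sum, ← Finset.sum_add_distrib]
        refine Finset.sum_congr rfl fun j _ => ?_
        rw [hdθ i j z.1 z.2]
        ring
      rw [Finset.sum_congr rfl fun i _ => h1 i, Finset.sum_add_distrib, ← Finset.mul_sum]
      congr 1
      · rw [← sum_fderiv_smul_fderiv_eq b (φ z.1) (e z.1) z.2, real_inner_comm, sum_inner]
        exact Finset.sum_congr rfl fun i _ => by rw [real_inner_smul_left]
      · rw [laplacian_eq_sum_fderiv_fderiv b (he2 z.1) z.2, real_inner_comm, sum_inner]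
    have hXsum : ∀ z : ℝ × E, ∑ i, ∑ j, (φ z.1 z.2 * c i j z.1 z.2) * ⟪G z.1 z.2 (b i), b j⟫ =
        φ z.1 z.2 * ∑ i, ⟪G z.1 z.2 (b i), fderiv ℝ (e z.1) z.2 (b i)⟫ := by
      intro z
      rw [Finset.mul_sum]
      refine Finset.sum_congr rfl fun i _ => ?_
      have hC : ∑ j, c i j z.1 z.2 * ⟪G z.1 z.2 (b i), b j⟫ = ⟪G z.1 z.2 (b i), fderiv ℝ (e z.1) z.2 (b i)⟫ := by
        rw [real_inner_comm, ← b.sum_inner_mul_inner (fderiv ℝ (e z.1) z.2 (b i)) (G z.1 z.2 (b i))]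
        refine Finset.sum_congr rfl fun j _ => ?_
        simp only [hc, real_inner_comm (b j) (G z.1 z.2 (b i))]
      rw [← hC, Finset.mul_sum]
      refine Finset.sum_congr rfl fun j _ => ?_
      ring
    simp only [hYsum, hXsum] at hsumY
    rw [integral_add iM2 iM1] at hsumY
    rw [hX1, hM1, hM2]
    linarith
  -- (NS) tested with `ψ = φ e`
  have hNS' : P1 + 2 * ν * M1 + P2 + P3 + ν * P4 + 2 * ν * M2 + P5 + P6 = 0 := by
    set ψ : ℝ → E → E := fun t x => φ t x • e t x with hψ_def
    have hψ : IsSpaceTimeTestOn Ω ψ := hφ.smul_field he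
    have h0 := hNS.2.2.2.2 ψ hψ
    -- the integrand in expanded form
    set NSI' : ℝ × E → ℝ := fun z =>
      timeDeriv φ z.1 z.2 * ⟪u z.1 z.2, e z.1 z.2⟫ +
        (2 * ν * (φ z.1 z.2 * ⟪u z.1 z.2, (Δ (e z.1)) z.2⟫) +
        (⟪u z.1 z.2, gradient (φ z.1) z.2⟫ * ⟪u z.1 z.2, e z.1 z.2⟫ +
        (φ z.1 z.2 * ⟪fderiv ℝ (e z.1) z.2 (u z.1 z.2), u z.1 z.2⟫ +
        (ν * ((Δ (φ z.1)) z.2 * ⟪u z.1 z.2, e z.1 z.2⟫) +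
        (2 * ν * ⟪u z.1 z.2, fderiv ℝ (e z.1) z.2 (gradient (φ z.1) z.2)⟫ +
        (p z.1 z.2 * ⟪e z.1 z.2, gradient (φ z.1) z.2⟫ +
        φ z.1 z.2 * ⟪u z.1 z.2, g z.1 z.2⟫)))))) with hNSI'
    have hpt : ∀ z ∈ (Ω : Set (ℝ × E)),
        ⟪u z.1 z.2, timeDeriv ψ z.1 z.2⟫ + ⟪u z.1 z.2, convect (u z.1) (ψ z.1) z.2⟫ +
          ν * ⟪u z.1 z.2, Δ (ψ z.1) z.2⟫ + p z.1 z.2 * VectorCalculus.divergence (ψ z.1) z.2 +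
          ⟪(0 : ℝ → E → E) z.1 z.2, ψ z.1 z.2⟫ = NSI' z := by
      intro z hz
      have ht : timeDeriv ψ z.1 z.2 = timeDeriv φ z.1 z.2 • e z.1 z.2 +
          φ z.1 z.2 • (ν • (Δ (e z.1)) z.2 + g z.1 z.2) := by
        rw [hψ_def, timeDeriv_smul_field hφ.contDiff he, (hheat z hz).deriv]
      have hcv : convect (u z.1) (ψ z.1) z.2 =
          ⟪u z.1 z.2, gradient (φ z.1) z.2⟫ • e z.1 z.2 + φ z.1 z.2 • convect (u z.1) (e z.1) z.2 :=
        convect_smul_field (hφd z.1 z.2) (hed z.1 z.2)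
      have hlap : (Δ (ψ z.1)) z.2 = φ z.1 z.2 • (Δ (e z.1)) z.2 +
          (2 : ℝ) • fderiv ℝ (e z.1) z.2 (gradient (φ z.1) z.2) + ((Δ (φ z.1)) z.2) • e z.1 z.2 :=
        laplacian_smul_field (hφ2 z.1) (he2 z.1) z.2
      have hdv : VectorCalculus.divergence (ψ z.1) z.2 = ⟪e z.1 z.2, gradient (φ z.1) z.2⟫ :=
        divergence_smul_field (hφd z.1 z.2) (hed z.1 z.2) (hdiv z hz)
      rw [ht, hcv, hlap, hdv, hNSI']
      simp only [inner_add_right, inner_smul_right, Pi.zero_apply, inner_zero_left, add_zero,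
        convect, real_inner_comm (fderiv ℝ (e z.1) z.2 (u z.1 z.2)) (u z.1 z.2)]
      ring
    have hzero : ∀ z : ℝ × E, z ∉ (Ω : Set (ℝ × E)) → NSI' z = 0 := by
      intro z hz
      have hzK : z ∉ K := fun h => hz (hKΩ h)
      simp only [hNSI', hφK z hzK, hφtK z hzK, hgφK z hzK, hLφK z hzK, map_zero, inner_zero_right,
        zero_mul, mul_zero, add_zero]
    have h1 : ∫ z : ℝ × E, NSI' z = 0 := by
      rw [← setIntegral_eq_integral_of_forall_compl_eq_zero (s := (Ω : Set (ℝ × E)))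
        (fun z hz => hzero z hz), ← h0]
      exact (setIntegral_congr_fun Ω.isOpen.measurableSet fun z hz => (hpt z hz).symm)
    -- split the integral
    have iM1' : Integrable (fun z : ℝ × E => 2 * ν * (φ z.1 z.2 * ⟪u z.1 z.2, (Δ (e z.1)) z.2⟫)) volume :=
      iM1.const_mul _
    have iP4' : Integrable (fun z : ℝ × E => ν * ((Δ (φ z.1)) z.2 * ⟪u z.1 z.2, e z.1 z.2⟫)) volume :=
      iP4.const_mul _
    have iM2' : Integrable (fun z : ℝ × E =>
        2 * ν * ⟪u z.1 z.2, fderiv ℝ (e z.1) z.2 (gradient (φ z.1) z.2)⟫) volume := iM2.const_mul _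
    have i7 : Integrable (fun z : ℝ × E =>
        p z.1 z.2 * ⟪e z.1 z.2, gradient (φ z.1) z.2⟫ +
        φ z.1 z.2 * ⟪u z.1 z.2, g z.1 z.2⟫) volume := iP5.add iP6
    have i6 : Integrable (fun z : ℝ × E =>
        2 * ν * ⟪u z.1 z.2, fderiv ℝ (e z.1) z.2 (gradient (φ z.1) z.2)⟫ +
        (p z.1 z.2 * ⟪e z.1 z.2, gradient (φ z.1) z.2⟫ +
        φ z.1 z.2 * ⟪u z.1 z.2, g z.1 z.2⟫)) volume := iM2'.add i7
    have i5 : Integrable (fun z : ℝ × E => ν * ((Δ (φ z.1)) z.2 * ⟪u z.1 z.2, e z.1 z.2⟫) +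
        (2 * ν * ⟪u z.1 z.2, fderiv ℝ (e z.1) z.2 (gradient (φ z.1) z.2)⟫ +
        (p z.1 z.2 * ⟪e z.1 z.2, gradient (φ z.1) z.2⟫ +
        φ z.1 z.2 * ⟪u z.1 z.2, g z.1 z.2⟫))) volume := iP4'.add i6
    have i4 : Integrable (fun z : ℝ × E => φ z.1 z.2 * ⟪fderiv ℝ (e z.1) z.2 (u z.1 z.2), u z.1 z.2⟫ +
        (ν * ((Δ (φ z.1)) z.2 * ⟪u z.1 z.2, e z.1 z.2⟫) +
        (2 * ν * ⟪u z.1 z.2, fderiv ℝ (e z.1) z.2 (gradient (φ z.1) z.2)⟫ +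
        (p z.1 z.2 * ⟪e z.1 z.2, gradient (φ z.1) z.2⟫ +
        φ z.1 z.2 * ⟪u z.1 z.2, g z.1 z.2⟫)))) volume := iP3.add i5
    have i3 : Integrable (fun z : ℝ × E => ⟪u z.1 z.2, gradient (φ z.1) z.2⟫ * ⟪u z.1 z.2, e z.1 z.2⟫ +
        (φ z.1 z.2 * ⟪fderiv ℝ (e z.1) z.2 (u z.1 z.2), u z.1 z.2⟫ +
        (ν * ((Δ (φ z.1)) z.2 * ⟪u z.1 z.2, e z.1 z.2⟫) +
        (2 * ν * ⟪u z.1 z.2, fderiv ℝ (e z.1) z.2 (gradient (φ z.1) z.2)⟫ +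
        (p z.1 z.2 * ⟪e z.1 z.2, gradient (φ z.1) z.2⟫ +
        φ z.1 z.2 * ⟪u z.1 z.2, g z.1 z.2⟫))))) volume := iP2.add i4
    have i2 : Integrable (fun z : ℝ × E => 2 * ν * (φ z.1 z.2 * ⟪u z.1 z.2, (Δ (e z.1)) z.2⟫) +
        (⟪u z.1 z.2, gradient (φ z.1) z.2⟫ * ⟪u z.1 z.2, e z.1 z.2⟫ +
        (φ z.1 z.2 * ⟪fderiv ℝ (e z.1) z.2 (u z.1 z.2), u z.1 z.2⟫ +
        (ν * ((Δ (φ z.1)) z.2 * ⟪u z.1 z.2, e z.1 z.2⟫) +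
        (2 * ν * ⟪u z.1 z.2, fderiv ℝ (e z.1) z.2 (gradient (φ z.1) z.2)⟫ +
        (p z.1 z.2 * ⟪e z.1 z.2, gradient (φ z.1) z.2⟫ +
        φ z.1 z.2 * ⟪u z.1 z.2, g z.1 z.2⟫)))))) volume := iM1'.add i3
    have hsplit : ∫ z : ℝ × E, NSI' z =
        P1 + 2 * ν * M1 + P2 + P3 + ν * P4 + 2 * ν * M2 + P5 + P6 := by
      rw [hNSI', integral_add iP1 i2, integral_add iM1' i3, integral_add iP2 i4, integral_add iP3 i5,
        integral_add iP4' i6, integral_add iM2' i7, integral_add iP5 iP6, integral_const_mul,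
        integral_const_mul, integral_const_mul, hP1, hM1, hP2, hP3, hP4, hM2, hP5, hP6]
      ring
    rw [hsplit] at h1
    exact h1
  -- ### (5) the expansions and the conclusion
  -- pointwise expansion of `|G - De|² φ`
  have hGw_pt : ∀ z : ℝ × E, frobeniusNormSq (G z.1 z.2 - fderiv ℝ (e z.1) z.2) * φ z.1 z.2 =
      frobeniusNormSq (G z.1 z.2) * φ z.1 z.2 -
        2 * (φ z.1 z.2 * ∑ i, ⟪G z.1 z.2 (b i), fderiv ℝ (e z.1) z.2 (b i)⟫) +
        φ z.1 z.2 * frobeniusNormSq (fderiv ℝ (e z.1) z.2) := by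
    intro z
    rw [frobeniusNormSq_eq_sum b, frobeniusNormSq_eq_sum b, frobeniusNormSq_eq_sum b, Finset.mul_sum,
      Finset.mul_sum, Finset.sum_mul, Finset.sum_mul, Finset.mul_sum, ← Finset.sum_sub_distrib,
      ← Finset.sum_add_distrib]
    refine Finset.sum_congr rfl fun i _ => ?_
    rw [_root_.sub_apply, norm_sub_sq_real]
    ring
  have iFI2 : Integrable (fun z : ℝ × E =>
      2 * (φ z.1 z.2 * ∑ i, ⟪G z.1 z.2 (b i), fderiv ℝ (e z.1) z.2 (b i)⟫)) volume := iFI.const_mul 2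
  have iLF : Integrable (fun z : ℝ × E => frobeniusNormSq (G z.1 z.2) * φ z.1 z.2 -
      2 * (φ z.1 z.2 * ∑ i, ⟪G z.1 z.2 (b i), fderiv ℝ (e z.1) z.2 (b i)⟫)) volume := iL.sub iFI2
  have iGw : Integrable (fun z : ℝ × E =>
      frobeniusNormSq (G z.1 z.2 - fderiv ℝ (e z.1) z.2) * φ z.1 z.2) volume :=
    (iLF.add iN).congr (Eventually.of_forall fun z => (hGw_pt z).symm)
  have hE1 : ∫ t, ∫ x, frobeniusNormSq (G t x - fderiv ℝ (e t) x) * φ t x = L - 2 * X1 + N := by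
    rw [← integral_prod (μ := volume) (ν := volume) _ iGw]
    change ∫ z : ℝ × E, frobeniusNormSq (G z.1 z.2 - fderiv ℝ (e z.1) z.2) * φ z.1 z.2 = L - 2 * X1 + N
    rw [funext hGw_pt, integral_add iLF iN, integral_sub iL iFI2, integral_const_mul, hL, hX1, hN]
  -- `W = ∫∫ |u - e|² (φₜ + νΔφ)`
  have hW_pt : ∀ z : ℝ × E, ‖u z.1 z.2 - e z.1 z.2‖ ^ 2 * (timeDeriv φ z.1 z.2 + ν * Δ (φ z.1) z.2) =
      (‖u z.1 z.2‖ ^ 2 * timeDeriv φ z.1 z.2 + ν * (‖u z.1 z.2‖ ^ 2 * (Δ (φ z.1)) z.2)) -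
        (2 * (timeDeriv φ z.1 z.2 * ⟪u z.1 z.2, e z.1 z.2⟫) +
          2 * ν * ((Δ (φ z.1)) z.2 * ⟪u z.1 z.2, e z.1 z.2⟫)) +
        (‖e z.1 z.2‖ ^ 2 * timeDeriv φ z.1 z.2 + ν * (‖e z.1 z.2‖ ^ 2 * (Δ (φ z.1)) z.2)) := by
    intro z
    rw [norm_sub_sq_real]
    ring
  have iA2' : Integrable (fun z : ℝ × E => ν * (‖u z.1 z.2‖ ^ 2 * (Δ (φ z.1)) z.2)) volume :=
    iA2.const_mul ν
  have iP1' : Integrable (fun z : ℝ × E => 2 * (timeDeriv φ z.1 z.2 * ⟪u z.1 z.2, e z.1 z.2⟫)) volume :=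
    iP1.const_mul 2
  have iP4'' : Integrable (fun z : ℝ × E => 2 * ν * ((Δ (φ z.1)) z.2 * ⟪u z.1 z.2, e z.1 z.2⟫)) volume :=
    iP4.const_mul _
  have iH2' : Integrable (fun z : ℝ × E => ν * (‖e z.1 z.2‖ ^ 2 * (Δ (φ z.1)) z.2)) volume :=
    iH2.const_mul ν
  have iAA : Integrable (fun z : ℝ × E => ‖u z.1 z.2‖ ^ 2 * timeDeriv φ z.1 z.2 +
      ν * (‖u z.1 z.2‖ ^ 2 * (Δ (φ z.1)) z.2)) volume := iA1.add iA2'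
  have iPP : Integrable (fun z : ℝ × E => 2 * (timeDeriv φ z.1 z.2 * ⟪u z.1 z.2, e z.1 z.2⟫) +
      2 * ν * ((Δ (φ z.1)) z.2 * ⟪u z.1 z.2, e z.1 z.2⟫)) volume := iP1'.add iP4''
  have iHH : Integrable (fun z : ℝ × E => ‖e z.1 z.2‖ ^ 2 * timeDeriv φ z.1 z.2 +
      ν * (‖e z.1 z.2‖ ^ 2 * (Δ (φ z.1)) z.2)) volume := iH1.add iH2'
  have iAP : Integrable (fun z : ℝ × E => (‖u z.1 z.2‖ ^ 2 * timeDeriv φ z.1 z.2 +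
      ν * (‖u z.1 z.2‖ ^ 2 * (Δ (φ z.1)) z.2)) -
      (2 * (timeDeriv φ z.1 z.2 * ⟪u z.1 z.2, e z.1 z.2⟫) +
        2 * ν * ((Δ (φ z.1)) z.2 * ⟪u z.1 z.2, e z.1 z.2⟫))) volume := iAA.sub iPP
  have iW : Integrable (fun z : ℝ × E =>
      ‖u z.1 z.2 - e z.1 z.2‖ ^ 2 * (timeDeriv φ z.1 z.2 + ν * Δ (φ z.1) z.2)) volume :=
    (iAP.add iHH).congr (Eventually.of_forall fun z => (hW_pt z).symm)
  have hE2 : ∫ t, ∫ x, ‖u t x - e t x‖ ^ 2 * (timeDeriv φ t x + ν * Δ (φ t) x) =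
      A1 + ν * A2 - (2 * P1 + 2 * ν * P4) + (H1 + ν * H2) := by
    rw [← integral_prod (μ := volume) (ν := volume) _ iW]
    change ∫ z : ℝ × E, ‖u z.1 z.2 - e z.1 z.2‖ ^ 2 * (timeDeriv φ z.1 z.2 + ν * Δ (φ z.1) z.2) = _
    rw [funext hW_pt, integral_add iAP iHH, integral_sub iAA iPP, integral_add iA1 iA2',
      integral_add iP1' iP4'', integral_add iH1 iH2', integral_const_mul, integral_const_mul,
      integral_const_mul, integral_const_mul, hA1, hA2, hP1, hP4, hH1, hH2]
  -- the transport term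
  have hT_pt : ∀ z : ℝ × E, (‖u z.1 z.2 - e z.1 z.2‖ ^ 2 - ‖e z.1 z.2‖ ^ 2) * ⟪u z.1 z.2, gradient (φ z.1) z.2⟫ =
      ‖u z.1 z.2‖ ^ 2 * ⟪u z.1 z.2, gradient (φ z.1) z.2⟫ -
        2 * (⟪u z.1 z.2, gradient (φ z.1) z.2⟫ * ⟪u z.1 z.2, e z.1 z.2⟫) := by
    intro z
    rw [norm_sub_sq_real]
    ring
  have iP2' : Integrable (fun z : ℝ × E =>
      2 * (⟪u z.1 z.2, gradient (φ z.1) z.2⟫ * ⟪u z.1 z.2, e z.1 z.2⟫)) volume := iP2.const_mul 2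
  have iT : Integrable (fun z : ℝ × E =>
      (‖u z.1 z.2 - e z.1 z.2‖ ^ 2 - ‖e z.1 z.2‖ ^ 2) * ⟪u z.1 z.2, gradient (φ z.1) z.2⟫) volume :=
    (iB1.sub iP2').congr (Eventually.of_forall fun z => (hT_pt z).symm)
  have hE3 : ∫ t, ∫ x, (‖u t x - e t x‖ ^ 2 - ‖e t x‖ ^ 2) * ⟪u t x, gradient (φ t) x⟫ =
      B1 - 2 * P2 := by
    rw [← integral_prod (μ := volume) (ν := volume) _ iT]
    change ∫ z : ℝ × E, (‖u z.1 z.2 - e z.1 z.2‖ ^ 2 - ‖e z.1 z.2‖ ^ 2) *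
      ⟪u z.1 z.2, gradient (φ z.1) z.2⟫ = _
    rw [funext hT_pt, integral_sub iB1 iP2', integral_const_mul, hB1, hP2]
  -- the pressure term
  have hPr_pt : ∀ z : ℝ × E, p z.1 z.2 * ⟪u z.1 z.2 - e z.1 z.2, gradient (φ z.1) z.2⟫ =
      p z.1 z.2 * ⟪u z.1 z.2, gradient (φ z.1) z.2⟫ - p z.1 z.2 * ⟪e z.1 z.2, gradient (φ z.1) z.2⟫ := by
    intro z
    rw [inner_sub_left]
    ring
  have iPr : Integrable (fun z : ℝ × E => p z.1 z.2 * ⟪u z.1 z.2 - e z.1 z.2, gradient (φ z.1) z.2⟫)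
      volume := (iB2.sub iP5).congr (Eventually.of_forall fun z => (hPr_pt z).symm)
  have hE4 : ∫ t, ∫ x, p t x * ⟪u t x - e t x, gradient (φ t) x⟫ = B2 - P5 := by
    rw [← integral_prod (μ := volume) (ν := volume) _ iPr]
    change ∫ z : ℝ × E, p z.1 z.2 * ⟪u z.1 z.2 - e z.1 z.2, gradient (φ z.1) z.2⟫ = _
    rw [funext hPr_pt, integral_sub iB2 iP5, hB2, hP5]
  have hE5 : ∫ t, ∫ x, φ t x * ⟪fderiv ℝ (e t) x (u t x), u t x⟫ = P3 :=
    (integral_prod (μ := volume) (ν := volume) _ iP3).symm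
  -- the forcing term
  have hF_pt : ∀ z : ℝ × E, φ z.1 z.2 * ⟪u z.1 z.2 - e z.1 z.2, g z.1 z.2⟫ =
      φ z.1 z.2 * ⟪u z.1 z.2, g z.1 z.2⟫ - φ z.1 z.2 * ⟪e z.1 z.2, g z.1 z.2⟫ := by
    intro z
    rw [inner_sub_left]
    ring
  have iFg : Integrable (fun z : ℝ × E => φ z.1 z.2 * ⟪u z.1 z.2 - e z.1 z.2, g z.1 z.2⟫) volume :=
    (iP6.sub iHg).congr (Eventually.of_forall fun z => (hF_pt z).symm)
  have hE6 : ∫ t, ∫ x, φ t x * ⟪u t x - e t x, g t x⟫ = P6 - Hg := by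
    rw [← integral_prod (μ := volume) (ν := volume) _ iFg]
    change ∫ z : ℝ × E, φ z.1 z.2 * ⟪u z.1 z.2 - e z.1 z.2, g z.1 z.2⟫ = _
    rw [funext hF_pt, integral_sub iP6 iHg, hP6, hHg]
  -- conclusion
  rw [hE1, hE2, hE3, hE4, hE5, hE6]
  have key : A1 + ν * A2 + B1 + 2 * B2 + 4 * ν * M1 + 4 * ν * M2 + 2 * ν * N =
      A1 + ν * A2 - (2 * P1 + 2 * ν * P4) + (H1 + ν * H2) + (B1 - 2 * P2) + 2 * (B2 - P5) - 2 * P3 -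
        2 * (P6 - Hg) := by
    linear_combination 2 * hNS' - hHeat
  calc 2 * ν * (L - 2 * X1 + N) = 2 * ν * L + 4 * ν * M1 + 4 * ν * M2 + 2 * ν * N := by
        linear_combination (-4 * ν) * hWG
    _ ≤ A1 + ν * A2 + B1 + 2 * B2 + 4 * ν * M1 + 4 * ν * M2 + 2 * ν * N := by linarith [hLEI']
    _ = _ := key

/-- **Local energy inequality of the remainder `w = u - e` for a forced regular field**, globally
divergence-free form (Jia–Šverák 2014, §3, proof of Thm. 3.1; Lemarié-Rieusset 2016, Thm. 14.7):
the statement of `forced_remainder_local_energy_inequality_localDiv` for a field `e` with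
`div e(t) = 0` for all `t` (the original form of this file; a one-line specialisation).
[cite: LemarieRieusset2016, Thm. 14.7, proof pp. 515–516] [cite: JiaSverak2014, §3 proof of Thm. 3.1 (arXiv p. 8)] -/
theorem forced_remainder_local_energy_inequality {g : ℝ → E → E}
    (hNS : IsDistributionalNSSolutionOn Ω ν 0 u p)
    (hG : HasWeakSpatialGradientOn Ω u G)
    (hG2 : ∀ K ⊆ (Ω : Set (ℝ × E)), IsCompact K →
      ∫⁻ z in K, ENNReal.ofReal (frobeniusNormSq (G z.1 z.2)) < ∞)
    (hLEI : ∀ φ : ℝ → E → ℝ, IsSpaceTimeTestOn Ω φ → (∀ t x, 0 ≤ φ t x) →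
      2 * ν * ∫ t, ∫ x, frobeniusNormSq (G t x) * φ t x ≤
        ∫ t, ∫ x, (‖u t x‖ ^ 2 * (timeDeriv φ t x + ν * Δ (φ t) x) +
          (‖u t x‖ ^ 2 + 2 * p t x) * ⟪u t x, gradient (φ t) x⟫ +
          2 * ⟪(0 : ℝ → E → E) t x, u t x⟫ * φ t x))
    (hu3 : ∀ K ⊆ (Ω : Set (ℝ × E)), IsCompact K → MemLp (uncurry u) 3 (volume.restrict K))
    (hp32 : ∀ K ⊆ (Ω : Set (ℝ × E)), IsCompact K → MemLp (uncurry p) (3 / 2) (volume.restrict K))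
    (he : ContDiff ℝ (⊤ : ℕ∞) (uncurry e)) (hg : Continuous (uncurry g))
    (hheat : ∀ z ∈ (Ω : Set (ℝ × E)),
      HasDerivAt (fun s => e s z.2) (ν • (Δ (e z.1)) z.2 + g z.1 z.2) z.1)
    (hdiv : ∀ t, VectorCalculus.IsDivFree (e t))
    (hφ : IsSpaceTimeTestOn Ω φ) (hφ0 : ∀ t x, 0 ≤ φ t x) :
    2 * ν * ∫ t, ∫ x, frobeniusNormSq (G t x - fderiv ℝ (e t) x) * φ t x ≤
      (∫ t, ∫ x, ‖u t x - e t x‖ ^ 2 * (timeDeriv φ t x + ν * Δ (φ t) x)) +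
        (∫ t, ∫ x, (‖u t x - e t x‖ ^ 2 - ‖e t x‖ ^ 2) * ⟪u t x, gradient (φ t) x⟫) +
        2 * (∫ t, ∫ x, p t x * ⟪u t x - e t x, gradient (φ t) x⟫) -
        2 * (∫ t, ∫ x, φ t x * ⟪fderiv ℝ (e t) x (u t x), u t x⟫) -
        2 * ∫ t, ∫ x, φ t x * ⟪u t x - e t x, g t x⟫ :=
  forced_remainder_local_energy_inequality_localDiv hNS hG hG2 hLEI hu3 hp32 he hg hheat
    (fun z _ => hdiv z.1 z.2) hφ hφ0

set_option maxHeartbeats 1600000 in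
/-- **The perturbed local energy inequality** (Jia–Šverák 2014, proof of Thm. 3.1,
arXiv:1204.0529 p. 8: the local energy inequality for `v = u - a`, where `a` is the regular
(mild, locally in time) solution and `u` the Leray solution; Lemarié-Rieusset 2016, proof of
Thm. 14.7, p. 516, "`∂ₜ(|w|²/2) = νΔ(|w|²/2) - ν|∇w|² - div(q w) - A - μ`"). Let `(u, p)` solve
the unforced Navier–Stokes equations in `𝒟'(Ω)` with a weak spatial gradient `G ∈ L²_loc(Ω)`
satisfying the CKN local energy inequality, `u ∈ L³_loc(Ω)`, `p ∈ L^{3/2}_loc(Ω)`; let `(a, π)`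
be jointly smooth with `∂ₜa = νΔa - (a·∇)a - ∇π` on `Ω` and `div a(t) = 0` for all `t` (a
classical Navier–Stokes flow on `Ω`, smooth on all of `ℝ × E`); let `φ ∈ C_c^∞(Ω)`, `φ ≥ 0`.
Then, with `v = u - a`, `∇v = G - Da`, `q = p - π` (iterated integrals over `ℝ` and `E`):

  `2ν ∫∫ |∇v|² φ ≤ ∫∫ |v|²(φₜ + νΔφ) + ∫∫ |v|² u·∇φ + 2 ∫∫ q v·∇φ - 2 ∫∫ φ ⟪Da(v), v⟫`

(the transport by `u = v + a`, the pressure `q` of the perturbation, and the stretching term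
`v·((v·∇)a)`). Proof: `forced_remainder_local_energy_inequality` with `g = -Da(a) - ∇π`, the
coupling `⟪Da(u), u⟫` expanded along `u = v + a` with `∫∫ φ⟪Da(v), a⟫ = -½∫∫ |a|² v·∇φ`,
`∫∫ φ⟪Da(a), a⟫ = -½∫∫ (a·∇φ)|a|²` (weak divergence-freeness of `u` and `div a = 0` tested
with `θ = ½|a|²φ`, as in the tree's `caloric_remainder_energy_inequality`), and
`∫∫ φ⟪v, ∇π⟫ = -∫∫ π v·∇φ` (the same with `θ = πφ`).
[cite: JiaSverak2014, §3 proof of Thm. 3.1 (arXiv p. 8)] [cite: LemarieRieusset2016, Thm. 14.7, proof p. 516] -/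
theorem perturbed_local_energy_inequality {π : ℝ → E → ℝ}
    (hNS : IsDistributionalNSSolutionOn Ω ν 0 u p)
    (hG : HasWeakSpatialGradientOn Ω u G)
    (hG2 : ∀ K ⊆ (Ω : Set (ℝ × E)), IsCompact K →
      ∫⁻ z in K, ENNReal.ofReal (frobeniusNormSq (G z.1 z.2)) < ∞)
    (hLEI : ∀ φ : ℝ → E → ℝ, IsSpaceTimeTestOn Ω φ → (∀ t x, 0 ≤ φ t x) →
      2 * ν * ∫ t, ∫ x, frobeniusNormSq (G t x) * φ t x ≤
        ∫ t, ∫ x, (‖u t x‖ ^ 2 * (timeDeriv φ t x + ν * Δ (φ t) x) +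
          (‖u t x‖ ^ 2 + 2 * p t x) * ⟪u t x, gradient (φ t) x⟫ +
          2 * ⟪(0 : ℝ → E → E) t x, u t x⟫ * φ t x))
    (hu3 : ∀ K ⊆ (Ω : Set (ℝ × E)), IsCompact K → MemLp (uncurry u) 3 (volume.restrict K))
    (hp32 : ∀ K ⊆ (Ω : Set (ℝ × E)), IsCompact K → MemLp (uncurry p) (3 / 2) (volume.restrict K))
    (he : ContDiff ℝ (⊤ : ℕ∞) (uncurry e)) (hπ : ContDiff ℝ (⊤ : ℕ∞) (uncurry π))
    (hmom : ∀ z ∈ (Ω : Set (ℝ × E)), HasDerivAt (fun s => e s z.2)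
      (ν • (Δ (e z.1)) z.2 + (-(fderiv ℝ (e z.1) z.2 (e z.1 z.2)) - gradient (π z.1) z.2)) z.1)
    (hdiv : ∀ t, VectorCalculus.IsDivFree (e t))
    (hφ : IsSpaceTimeTestOn Ω φ) (hφ0 : ∀ t x, 0 ≤ φ t x) :
    2 * ν * ∫ t, ∫ x, frobeniusNormSq (G t x - fderiv ℝ (e t) x) * φ t x ≤
      (∫ t, ∫ x, ‖u t x - e t x‖ ^ 2 * (timeDeriv φ t x + ν * Δ (φ t) x)) +
        (∫ t, ∫ x, ‖u t x - e t x‖ ^ 2 * ⟪u t x, gradient (φ t) x⟫) +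
        2 * (∫ t, ∫ x, (p t x - π t x) * ⟪u t x - e t x, gradient (φ t) x⟫) -
        2 * ∫ t, ∫ x, φ t x * ⟪fderiv ℝ (e t) x (u t x - e t x), u t x - e t x⟫ := by
  -- the forcing `g = -Da(a) - ∇π` and its continuity
  set g : ℝ → E → E := fun t x => -(fderiv ℝ (e t) x (e t x)) - gradient (π t) x with hg_def
  have hes0 : IsSmoothSpaceTimeOn univ e := IsSmoothSpaceTimeOn.of_contDiff_univ he
  have hπs0 : IsSmoothSpaceTimeOn univ π := IsSmoothSpaceTimeOn.of_contDiff_univ hπ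
  have hgπ_c : Continuous fun z : ℝ × E => gradient (π z.1) z.2 :=
    (hπs0.gradient uniqueDiffOn_univ).continuous_of_univ
  have hπ_c : Continuous fun z : ℝ × E => π z.1 z.2 := hπs0.continuous_of_univ
  have hg : Continuous (uncurry g) := by
    have h1 : Continuous fun z : ℝ × E => fderiv ℝ (e z.1) z.2 (e z.1 z.2) :=
      ((hes0.fderiv_slice uniqueDiffOn_univ).continuous_of_univ).clm_apply hes0.continuous_of_univ
    exact h1.neg.sub hgπ_c
  have hheat : ∀ z ∈ (Ω : Set (ℝ × E)),
      HasDerivAt (fun s => e s z.2) (ν • (Δ (e z.1)) z.2 + g z.1 z.2) z.1 := fun z hz => hmom z hz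
  have h4 := forced_remainder_local_energy_inequality hNS hG hG2 hLEI hu3 hp32 he hg hheat hdiv hφ hφ0
  haveI : (volume : Measure (ℝ × E)).IsAddHaarMeasure := Measure.prod.instIsAddHaarMeasure _ _
  haveI hHT31 : ENNReal.HolderTriple (3 / 2) 3 1 := by
    refine ⟨?_⟩
    rw [ENNReal.inv_div (Or.inr (by norm_num)) (Or.inr (by norm_num)), inv_one,
      show (3 : ℝ≥0∞)⁻¹ = 1 / 3 by rw [one_div], ENNReal.div_add_div_same,
      show (2 : ℝ≥0∞) + 1 = 3 by norm_num, ENNReal.div_self (by norm_num) (by norm_num)]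
  set b := stdOrthonormalBasis ℝ E with hb
  -- ### (0) smoothness and continuity of the weights
  have hes : IsSmoothSpaceTimeOn univ e := IsSmoothSpaceTimeOn.of_contDiff_univ he
  have hφs : IsSmoothSpaceTimeOn univ φ := hφ.isSmoothSpaceTimeOn univ
  have he_c : Continuous fun z : ℝ × E => e z.1 z.2 := hes.continuous_of_univ
  have hφ_c : Continuous fun z : ℝ × E => φ z.1 z.2 := hφs.continuous_of_univ
  have hLe_c : Continuous fun z : ℝ × E => (Δ (e z.1)) z.2 :=
    (hes.laplacian uniqueDiffOn_univ).continuous_of_univ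
  have hLφ_c : Continuous fun z : ℝ × E => (Δ (φ z.1)) z.2 :=
    (hφs.laplacian uniqueDiffOn_univ).continuous_of_univ
  have hDes : IsSmoothSpaceTimeOn univ fun t x => fderiv ℝ (e t) x := hes.fderiv_slice uniqueDiffOn_univ
  have hDe_c : Continuous fun z : ℝ × E => fderiv ℝ (e z.1) z.2 := hDes.continuous_of_univ
  have hgφ_c : Continuous fun z : ℝ × E => gradient (φ z.1) z.2 :=
    (hφs.gradient uniqueDiffOn_univ).continuous_of_univ
  have hφt_c : Continuous fun z : ℝ × E => timeDeriv φ z.1 z.2 := hφ.continuous_timeDeriv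
  have hfrob_c : Continuous fun L : E →L[ℝ] E => frobeniusNormSq L := by
    have : (fun L : E →L[ℝ] E => frobeniusNormSq L) = fun L => ∑ i, ‖L (b i)‖ ^ 2 :=
      funext fun L => frobeniusNormSq_eq_sum b L
    rw [this]
    exact continuous_finsetSum _ fun i _ =>
      ((ContinuousLinearMap.apply ℝ E (b i)).continuous.norm).pow 2
  have he2 : ∀ t, ContDiff ℝ 2 (e t) := fun t => contDiff_infty.1 (contDiff_slice_field (F := E) he t) 2
  have he1 : ∀ t, ContDiff ℝ 1 (e t) := fun t => (he2 t).of_le one_le_two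
  have hed : ∀ t x, DifferentiableAt ℝ (e t) x := fun t x => (he1 t).differentiable one_ne_zero x
  have hφ2 : ∀ t, ContDiff ℝ 2 (φ t) := fun t => contDiff_infty.1 (hφ.contDiff_slice t) 2
  have hφd : ∀ t x, DifferentiableAt ℝ (φ t) x := fun t x =>
    ((hφ2 t).differentiable (by norm_num)) x
  -- ### (1) the support and the classes of `u`, `p`, `G` on it
  set K : Set (ℝ × E) := tsupport (uncurry φ) with hK
  have hKc : IsCompact K := hφ.hasCompactSupport
  have hKΩ : K ⊆ (Ω : Set (ℝ × E)) := hφ.tsupport_subset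
  have hKm : MeasurableSet K := hKc.measurableSet
  haveI hKfin : IsFiniteMeasure (volume.restrict K) := ⟨by
    rw [Measure.restrict_apply_univ]; exact hKc.measure_lt_top⟩
  have hφK : ∀ z : ℝ × E, z ∉ K → φ z.1 z.2 = 0 := fun z hz =>
    image_eq_zero_of_notMem_tsupport (f := uncurry φ) hz
  have hφtK : ∀ z : ℝ × E, z ∉ K → timeDeriv φ z.1 z.2 = 0 := fun z hz =>
    IsSpaceTimeTestOn.timeDeriv_eq_zero_of_notMem hz
  have hnear : ∀ z : ℝ × E, z ∉ K → φ z.1 =ᶠ[𝓝 z.2] fun _ => (0 : ℝ) := fun z hz => by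
    have h0 : uncurry φ =ᶠ[𝓝 (z.1, z.2)] 0 := notMem_tsupport_iff_eventuallyEq.1 hz
    have hc : Continuous fun y : E => (z.1, y) := continuous_const.prodMk continuous_id
    exact (hc.tendsto z.2).eventually h0
  have hgφK : ∀ z : ℝ × E, z ∉ K → gradient (φ z.1) z.2 = 0 := fun z hz => by
    rw [gradient, (hnear z hz).fderiv_eq, fderiv_fun_const, Pi.zero_apply, map_zero]
  have hLφK : ∀ z : ℝ × E, z ∉ K → (Δ (φ z.1)) z.2 = 0 := fun z hz => by
    rw [(InnerProductSpace.laplacian_congr_nhds (hnear z hz)).self_of_nhds,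
      InnerProductSpace.laplacian_const, Pi.zero_apply]
  -- the classes
  have huK : MemLp (uncurry u) 3 (volume.restrict K) := hu3 K hKΩ hKc
  have hpK : MemLp (uncurry p) (3 / 2) (volume.restrict K) := hp32 K hKΩ hKc
  have hum : AEStronglyMeasurable (uncurry u) (volume.restrict K) := huK.aestronglyMeasurable
  have hpm : AEStronglyMeasurable (uncurry p) (volume.restrict K) := hpK.aestronglyMeasurable
  have hGm : AEStronglyMeasurable (uncurry G) (volume.restrict K) :=
    (hG.locallyIntegrableOn_grad.aestronglyMeasurable).mono_measure (Measure.restrict_mono hKΩ le_rfl)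
  have hum' : AEStronglyMeasurable (fun z : ℝ × E => u z.1 z.2) (volume.restrict K) := hum
  have hpm' : AEStronglyMeasurable (fun z : ℝ × E => p z.1 z.2) (volume.restrict K) := hpm
  have hGm' : AEStronglyMeasurable (fun z : ℝ × E => G z.1 z.2) (volume.restrict K) := hGm
  have hu2K : MemLp (uncurry u) 2 (volume.restrict K) := huK.mono_exponent (by norm_num)
  -- integrable dominating functions on `K`
  have gU2 : IntegrableOn (fun z : ℝ × E => ‖u z.1 z.2‖ ^ 2) K volume :=
    hu2K.integrable_norm_pow two_ne_zero
  have gU3 : IntegrableOn (fun z : ℝ × E => ‖u z.1 z.2‖ ^ 3) K volume :=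
    huK.integrable_norm_pow (by norm_num)
  have gU1 : IntegrableOn (fun z : ℝ × E => ‖u z.1 z.2‖) K volume :=
    (huK.integrable (by norm_num)).norm
  have h1le32 : (1 : ℝ≥0∞) ≤ 3 / 2 := by
    rw [ENNReal.le_div_iff_mul_le (Or.inl (by norm_num)) (Or.inl (by norm_num))]
    norm_num
  have gP1 : IntegrableOn (fun z : ℝ × E => ‖p z.1 z.2‖) K volume :=
    (hpK.integrable h1le32).norm
  have gPU : IntegrableOn (fun z : ℝ × E => ‖p z.1 z.2‖ * ‖u z.1 z.2‖) K volume := by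
    have h := MemLp.mul' (r := 1) (f := fun z : ℝ × E => ‖u z.1 z.2‖)
      (φ := fun z : ℝ × E => ‖p z.1 z.2‖) huK.norm hpK.norm
    exact memLp_one_iff_integrable.1 h
  have gG2 : IntegrableOn (fun z : ℝ × E => frobeniusNormSq (G z.1 z.2)) K volume := by
    refine ⟨(hfrob_c.comp_aestronglyMeasurable hGm'), ?_⟩
    have hfin := hG2 K hKΩ hKc
    refine lt_of_le_of_lt (lintegral_mono fun z => ?_) hfin
    rw [Real.enorm_eq_ofReal (frobeniusNormSq_nonneg _)]
  have gGi : ∀ i, IntegrableOn (fun z : ℝ × E => ‖G z.1 z.2 (b i)‖) K volume := by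
    intro i
    have hmeas : AEStronglyMeasurable (fun z : ℝ × E => G z.1 z.2 (b i)) (volume.restrict K) :=
      (ContinuousLinearMap.apply ℝ E (b i)).continuous.comp_aestronglyMeasurable hGm'
    have h2 : MemLp (fun z : ℝ × E => G z.1 z.2 (b i)) 2 (volume.restrict K) := by
      refine (memLp_two_iff_integrable_sq_norm hmeas).2 ?_
      refine Integrable.mono' gG2 (hmeas.norm.pow 2) (Eventually.of_forall fun z => ?_)
      rw [Real.norm_eq_abs, abs_of_nonneg (sq_nonneg _)]
      exact norm_apply_sq_le_frobeniusNormSq b _ i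
    exact (h2.integrable one_le_two).norm
  -- bounds of the weights on `K`
  obtain ⟨Cφ, hCφ0, hCφ⟩ := exists_forall_mem_norm_le_of_continuous hKc hφ_c
  obtain ⟨Cφt, hCφt0, hCφt⟩ := exists_forall_mem_norm_le_of_continuous hKc hφt_c
  obtain ⟨CLφ, hCLφ0, hCLφ⟩ := exists_forall_mem_norm_le_of_continuous hKc hLφ_c
  obtain ⟨Cgφ, hCgφ0, hCgφ⟩ := exists_forall_mem_norm_le_of_continuous hKc hgφ_c
  obtain ⟨Ce, hCe0, hCe⟩ := exists_forall_mem_norm_le_of_continuous hKc he_c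
  obtain ⟨CDe, hCDe0, hCDe⟩ := exists_forall_mem_norm_le_of_continuous hKc hDe_c
  obtain ⟨CLe, hCLe0, hCLe⟩ := exists_forall_mem_norm_le_of_continuous hKc hLe_c
  have hDeu : AEStronglyMeasurable (fun z : ℝ × E => fderiv ℝ (e z.1) z.2 (u z.1 z.2))
      (volume.restrict K) :=
    (isBoundedBilinearMap_apply (𝕜 := ℝ) (E := E) (F := E)).continuous.comp_aestronglyMeasurable₂
      hDe_c.aestronglyMeasurable hum'
  have iP3 : Integrable (fun z : ℝ × E =>
      φ z.1 z.2 * ⟪fderiv ℝ (e z.1) z.2 (u z.1 z.2), u z.1 z.2⟫) volume := by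
    refine integrable_of_bound_on_compact hKc (gU2.const_mul (Cφ * CDe))
      (hφ_c.aestronglyMeasurable.mul (hDeu.inner hum'))
      (fun z hz => by rw [hφK z hz, zero_mul]) fun z hz => ?_
    rw [norm_mul]
    calc ‖φ z.1 z.2‖ * ‖⟪fderiv ℝ (e z.1) z.2 (u z.1 z.2), u z.1 z.2⟫‖
        ≤ Cφ * ((CDe * ‖u z.1 z.2‖) * ‖u z.1 z.2‖) :=
          mul_le_mul (hCφ z hz) ((norm_inner_le_norm _ _).trans (mul_le_mul_of_nonneg_right
            ((ContinuousLinearMap.le_opNorm _ _).trans (mul_le_mul_of_nonneg_right (hCDe z hz)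
            (norm_nonneg _))) (norm_nonneg _))) (norm_nonneg _) hCφ0
      _ = Cφ * CDe * ‖u z.1 z.2‖ ^ 2 := by ring
  -- the classes of `w = u - e` on `K`
  have hwm' : AEStronglyMeasurable (fun z : ℝ × E => u z.1 z.2 - e z.1 z.2) (volume.restrict K) :=
    hum'.sub he_c.aestronglyMeasurable
  have gW2 : IntegrableOn (fun z : ℝ × E => ‖u z.1 z.2 - e z.1 z.2‖ ^ 2) K volume := by
    refine Integrable.mono' ((gU2.const_mul 2).add (integrableOn_const (C := 2 * Ce ^ 2)
      (hs := hKc.measure_lt_top.ne) |>.integrable)) (hwm'.norm.pow 2) ?_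
    refine (ae_restrict_iff' hKm).2 (Eventually.of_forall fun z hz => ?_)
    rw [Real.norm_eq_abs, abs_of_nonneg (sq_nonneg _)]
    calc ‖u z.1 z.2 - e z.1 z.2‖ ^ 2 ≤ (‖u z.1 z.2‖ + ‖e z.1 z.2‖) ^ 2 := by
          gcongr; exact norm_sub_le _ _
      _ ≤ 2 * ‖u z.1 z.2‖ ^ 2 + 2 * ‖e z.1 z.2‖ ^ 2 := by nlinarith [sq_nonneg (‖u z.1 z.2‖ - ‖e z.1 z.2‖)]
      _ ≤ 2 * ‖u z.1 z.2‖ ^ 2 + 2 * Ce ^ 2 := by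
          have := hCe z hz
          nlinarith [norm_nonneg (e z.1 z.2)]
  -- ### integrands of the expansion
  have hDw_c : AEStronglyMeasurable (fun z : ℝ × E => fderiv ℝ (e z.1) z.2 (u z.1 z.2 - e z.1 z.2))
      (volume.restrict K) :=
    (isBoundedBilinearMap_apply (𝕜 := ℝ) (E := E) (F := E)).continuous.comp_aestronglyMeasurable₂
      hDe_c.aestronglyMeasurable hwm'
  have hDee_c : Continuous fun z : ℝ × E => fderiv ℝ (e z.1) z.2 (e z.1 z.2) := hDe_c.clm_apply he_c
  -- `φ ⟪De(w), w⟫`, `φ ⟪De(w), e⟫`, `φ ⟪De(e), w⟫`, `φ ⟪De(e), e⟫`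
  have iT1 : Integrable (fun z : ℝ × E =>
      φ z.1 z.2 * ⟪fderiv ℝ (e z.1) z.2 (u z.1 z.2 - e z.1 z.2), u z.1 z.2 - e z.1 z.2⟫) volume := by
    refine integrable_of_bound_on_compact hKc (gW2.const_mul (Cφ * CDe))
      (hφ_c.aestronglyMeasurable.mul (hDw_c.inner hwm'))
      (fun z hz => by rw [hφK z hz, zero_mul]) fun z hz => ?_
    rw [norm_mul]
    calc ‖φ z.1 z.2‖ * ‖⟪fderiv ℝ (e z.1) z.2 (u z.1 z.2 - e z.1 z.2), u z.1 z.2 - e z.1 z.2⟫‖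
        ≤ Cφ * ((CDe * ‖u z.1 z.2 - e z.1 z.2‖) * ‖u z.1 z.2 - e z.1 z.2‖) :=
          mul_le_mul (hCφ z hz) ((norm_inner_le_norm _ _).trans (mul_le_mul_of_nonneg_right
            ((ContinuousLinearMap.le_opNorm _ _).trans (mul_le_mul_of_nonneg_right (hCDe z hz)
            (norm_nonneg _))) (norm_nonneg _))) (norm_nonneg _) hCφ0
      _ = Cφ * CDe * ‖u z.1 z.2 - e z.1 z.2‖ ^ 2 := by ring
  have iD2 : Integrable (fun z : ℝ × E =>
      φ z.1 z.2 * ⟪fderiv ℝ (e z.1) z.2 (u z.1 z.2 - e z.1 z.2), e z.1 z.2⟫) volume := by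
    have gW1 : IntegrableOn (fun z : ℝ × E => ‖u z.1 z.2 - e z.1 z.2‖) K volume :=
      Integrable.mono' (gU1.add (integrableOn_const (C := Ce) (hs := hKc.measure_lt_top.ne)
        |>.integrable)) hwm'.norm ((ae_restrict_iff' hKm).2 (Eventually.of_forall fun z hz => by
          rw [norm_norm]; exact (norm_sub_le _ _).trans (add_le_add le_rfl (hCe z hz))))
    refine integrable_of_bound_on_compact hKc (gW1.const_mul (Cφ * CDe * Ce))
      (hφ_c.aestronglyMeasurable.mul (hDw_c.inner he_c.aestronglyMeasurable))
      (fun z hz => by rw [hφK z hz, zero_mul]) fun z hz => ?_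
    rw [norm_mul]
    calc ‖φ z.1 z.2‖ * ‖⟪fderiv ℝ (e z.1) z.2 (u z.1 z.2 - e z.1 z.2), e z.1 z.2⟫‖
        ≤ Cφ * ((CDe * ‖u z.1 z.2 - e z.1 z.2‖) * Ce) :=
          mul_le_mul (hCφ z hz) ((norm_inner_le_norm _ _).trans (mul_le_mul
            ((ContinuousLinearMap.le_opNorm _ _).trans (mul_le_mul_of_nonneg_right (hCDe z hz)
            (norm_nonneg _))) (hCe z hz) (norm_nonneg _) (by positivity))) (norm_nonneg _) hCφ0
      _ = Cφ * CDe * Ce * ‖u z.1 z.2 - e z.1 z.2‖ := by ring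
  have iT2 : Integrable (fun z : ℝ × E =>
      φ z.1 z.2 * ⟪fderiv ℝ (e z.1) z.2 (e z.1 z.2), u z.1 z.2 - e z.1 z.2⟫) volume := by
    have gW1 : IntegrableOn (fun z : ℝ × E => ‖u z.1 z.2 - e z.1 z.2‖) K volume :=
      Integrable.mono' (gU1.add (integrableOn_const (C := Ce) (hs := hKc.measure_lt_top.ne)
        |>.integrable)) hwm'.norm ((ae_restrict_iff' hKm).2 (Eventually.of_forall fun z hz => by
          rw [norm_norm]; exact (norm_sub_le _ _).trans (add_le_add le_rfl (hCe z hz))))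
    refine integrable_of_bound_on_compact hKc (gW1.const_mul (Cφ * (CDe * Ce)))
      (hφ_c.aestronglyMeasurable.mul (hDee_c.aestronglyMeasurable.inner hwm'))
      (fun z hz => by rw [hφK z hz, zero_mul]) fun z hz => ?_
    rw [norm_mul]
    calc ‖φ z.1 z.2‖ * ‖⟪fderiv ℝ (e z.1) z.2 (e z.1 z.2), u z.1 z.2 - e z.1 z.2⟫‖
        ≤ Cφ * ((CDe * Ce) * ‖u z.1 z.2 - e z.1 z.2‖) :=
          mul_le_mul (hCφ z hz) ((norm_inner_le_norm _ _).trans (mul_le_mul_of_nonneg_right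
            ((ContinuousLinearMap.le_opNorm _ _).trans (mul_le_mul (hCDe z hz) (hCe z hz)
            (norm_nonneg _) hCDe0)) (norm_nonneg _))) (norm_nonneg _) hCφ0
      _ = Cφ * (CDe * Ce) * ‖u z.1 z.2 - e z.1 z.2‖ := by ring
  have hint : ∀ {f : ℝ × E → ℝ}, Continuous f → (∀ z ∉ K, f z = 0) → Integrable f volume :=
    fun hf h0 => hf.integrable_of_hasCompactSupport (HasCompactSupport.intro hKc h0)
  have iD3 : Integrable (fun z : ℝ × E => φ z.1 z.2 * ⟪fderiv ℝ (e z.1) z.2 (e z.1 z.2), e z.1 z.2⟫) volume :=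
    hint (hφ_c.mul (hDee_c.inner he_c)) fun z hz => by rw [hφK z hz, zero_mul]
  -- the splitting `⟪De(u), u⟫ = ⟪De(w), w⟫ + ⟪De(w), e⟫ + ⟪De(e), w⟫ + ⟪De(e), e⟫`
  have hP3_pt : ∀ z : ℝ × E, φ z.1 z.2 * ⟪fderiv ℝ (e z.1) z.2 (u z.1 z.2), u z.1 z.2⟫ =
      φ z.1 z.2 * ⟪fderiv ℝ (e z.1) z.2 (u z.1 z.2 - e z.1 z.2), u z.1 z.2 - e z.1 z.2⟫ +
        (φ z.1 z.2 * ⟪fderiv ℝ (e z.1) z.2 (u z.1 z.2 - e z.1 z.2), e z.1 z.2⟫ +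
        (φ z.1 z.2 * ⟪fderiv ℝ (e z.1) z.2 (e z.1 z.2), u z.1 z.2 - e z.1 z.2⟫ +
        φ z.1 z.2 * ⟪fderiv ℝ (e z.1) z.2 (e z.1 z.2), e z.1 z.2⟫)) := by
    intro z
    have hu : u z.1 z.2 = (u z.1 z.2 - e z.1 z.2) + e z.1 z.2 := (sub_add_cancel _ _).symm
    conv_lhs => rw [hu]
    simp only [map_add, inner_add_left, inner_add_right]
    ring
  have hP3 : ∫ t, ∫ x, φ t x * ⟪fderiv ℝ (e t) x (u t x), u t x⟫ =
      (∫ z : ℝ × E, φ z.1 z.2 * ⟪fderiv ℝ (e z.1) z.2 (u z.1 z.2 - e z.1 z.2), u z.1 z.2 - e z.1 z.2⟫) +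
      ((∫ z : ℝ × E, φ z.1 z.2 * ⟪fderiv ℝ (e z.1) z.2 (u z.1 z.2 - e z.1 z.2), e z.1 z.2⟫) +
      ((∫ z : ℝ × E, φ z.1 z.2 * ⟪fderiv ℝ (e z.1) z.2 (e z.1 z.2), u z.1 z.2 - e z.1 z.2⟫) +
      ∫ z : ℝ × E, φ z.1 z.2 * ⟪fderiv ℝ (e z.1) z.2 (e z.1 z.2), e z.1 z.2⟫)) := by
    rw [← integral_prod (μ := volume) (ν := volume) _ iP3]
    change ∫ z : ℝ × E, φ z.1 z.2 * ⟪fderiv ℝ (e z.1) z.2 (u z.1 z.2), u z.1 z.2⟫ = _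
    have i34 : Integrable (fun z : ℝ × E =>
        φ z.1 z.2 * ⟪fderiv ℝ (e z.1) z.2 (e z.1 z.2), u z.1 z.2 - e z.1 z.2⟫ +
        φ z.1 z.2 * ⟪fderiv ℝ (e z.1) z.2 (e z.1 z.2), e z.1 z.2⟫) volume := iT2.add iD3
    have i234 : Integrable (fun z : ℝ × E =>
        φ z.1 z.2 * ⟪fderiv ℝ (e z.1) z.2 (u z.1 z.2 - e z.1 z.2), e z.1 z.2⟫ +
        (φ z.1 z.2 * ⟪fderiv ℝ (e z.1) z.2 (e z.1 z.2), u z.1 z.2 - e z.1 z.2⟫ +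
        φ z.1 z.2 * ⟪fderiv ℝ (e z.1) z.2 (e z.1 z.2), e z.1 z.2⟫)) volume := iD2.add i34
    rw [funext hP3_pt, integral_add iT1 i234, integral_add iD2 i34, integral_add iT2 iD3]
  -- ### (ii) weak divergence-freeness tested with `θ = ½ |e|² φ`
  have hθs : ContDiff ℝ ((⊤ : ℕ∞) : WithTop ℕ∞) (uncurry fun t x => (1 / 2 : ℝ) * ‖e t x‖ ^ 2) := by
    have : (uncurry fun t x => (1 / 2 : ℝ) * ‖e t x‖ ^ 2) = fun z => (1 / 2 : ℝ) * ‖uncurry e z‖ ^ 2 := rfl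
    rw [this]
    exact contDiff_const.mul (he.norm_sq (𝕜 := ℝ))
  have hθ : IsSpaceTimeTestOn Ω fun t x => φ t x * ((1 / 2 : ℝ) * ‖e t x‖ ^ 2) := hφ.mul_smooth hθs
  have hgradθ : ∀ t x (v : E), ⟪v, gradient (fun y => φ t y * ((1 / 2 : ℝ) * ‖e t y‖ ^ 2)) x⟫ =
      φ t x * ⟪fderiv ℝ (e t) x v, e t x⟫ + (1 / 2 : ℝ) * ‖e t x‖ ^ 2 * ⟪v, gradient (φ t) x⟫ := by
    intro t x v
    have hn2 : DifferentiableAt ℝ (fun y => ‖e t y‖ ^ 2) x := (hed t x).norm_sq (𝕜 := ℝ)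
    have hn : DifferentiableAt ℝ (fun y => (1 / 2 : ℝ) * ‖e t y‖ ^ 2) x := hn2.const_mul _
    rw [real_inner_comm, gradient, InnerProductSpace.toDual_symm_apply, fderiv_fun_mul (hφd t x) hn,
      fderiv_const_mul hn2]
    have h2 : fderiv ℝ (fun y => ‖e t y‖ ^ 2) x v = 2 * ⟪fderiv ℝ (e t) x v, e t x⟫ := by
      have : (fun y => ‖e t y‖ ^ 2) = fun y => ⟪e t y, e t y⟫ := funext fun y =>
        (real_inner_self_eq_norm_sq _).symm
      rw [this, fderiv_inner_apply ℝ (hed t x) (hed t x), real_inner_comm (e t x)]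
      ring
    simp only [_root_.add_apply, _root_.FunLike.coe_smul, Pi.smul_apply, smul_eq_mul, h2]
    rw [real_inner_comm (gradient (φ t) x), gradient, InnerProductSpace.toDual_symm_apply]
    ring
  -- for `u` (weakly divergence free on `Ω`)
  have i_ue : Integrable (fun z : ℝ × E => (1 / 2 : ℝ) * ‖e z.1 z.2‖ ^ 2 * ⟪u z.1 z.2, gradient (φ z.1) z.2⟫)
      volume := by
    refine integrable_of_bound_on_compact hKc (gU1.const_mul ((1 / 2 : ℝ) * Ce ^ 2 * Cgφ))
      ((continuous_const.mul (he_c.norm.pow 2)).aestronglyMeasurable.mul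
        (hum'.inner hgφ_c.aestronglyMeasurable))
      (fun z hz => by rw [hgφK z hz, inner_zero_right, mul_zero]) fun z hz => ?_
    rw [norm_mul, norm_mul, Real.norm_eq_abs, abs_of_nonneg (by norm_num : (0 : ℝ) ≤ 1 / 2),
      Real.norm_eq_abs, abs_of_nonneg (sq_nonneg _)]
    calc (1 / 2 : ℝ) * ‖e z.1 z.2‖ ^ 2 * ‖⟪u z.1 z.2, gradient (φ z.1) z.2⟫‖
        ≤ (1 / 2 : ℝ) * Ce ^ 2 * (‖u z.1 z.2‖ * Cgφ) := by
          refine mul_le_mul (mul_le_mul_of_nonneg_left ?_ (by norm_num)) ((norm_inner_le_norm _ _).trans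
            (mul_le_mul_of_nonneg_left (hCgφ z hz) (norm_nonneg _))) (norm_nonneg _) (by positivity)
          have := hCe z hz
          exact pow_le_pow_left₀ (norm_nonneg _) this 2
      _ = (1 / 2 : ℝ) * Ce ^ 2 * Cgφ * ‖u z.1 z.2‖ := by ring
  have iP3u : Integrable (fun z : ℝ × E => φ z.1 z.2 * ⟪fderiv ℝ (e z.1) z.2 (u z.1 z.2), e z.1 z.2⟫)
      volume := by
    refine integrable_of_bound_on_compact hKc (gU1.const_mul (Cφ * CDe * Ce))
      (hφ_c.aestronglyMeasurable.mul (hDeu.inner he_c.aestronglyMeasurable))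
      (fun z hz => by rw [hφK z hz, zero_mul]) fun z hz => ?_
    rw [norm_mul]
    calc ‖φ z.1 z.2‖ * ‖⟪fderiv ℝ (e z.1) z.2 (u z.1 z.2), e z.1 z.2⟫‖
        ≤ Cφ * ((CDe * ‖u z.1 z.2‖) * Ce) :=
          mul_le_mul (hCφ z hz) ((norm_inner_le_norm _ _).trans (mul_le_mul
            ((ContinuousLinearMap.le_opNorm _ _).trans (mul_le_mul_of_nonneg_right (hCDe z hz)
            (norm_nonneg _))) (hCe z hz) (norm_nonneg _) (by positivity))) (norm_nonneg _) hCφ0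
      _ = Cφ * CDe * Ce * ‖u z.1 z.2‖ := by ring
  have hD_u : (∫ z : ℝ × E, φ z.1 z.2 * ⟪fderiv ℝ (e z.1) z.2 (u z.1 z.2), e z.1 z.2⟫) +
      ∫ z : ℝ × E, (1 / 2 : ℝ) * ‖e z.1 z.2‖ ^ 2 * ⟪u z.1 z.2, gradient (φ z.1) z.2⟫ = 0 := by
    have h0 := hNS.2.2.2.1 _ hθ
    rw [setIntegral_eq_integral_of_forall_compl_eq_zero (fun z hz => by
      have hzK : z ∉ K := fun h => hz (hKΩ h)
      rw [hgradθ, hφK z hzK, hgφK z hzK, inner_zero_right, zero_mul, mul_zero, add_zero])] at h0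
    simp only [hgradθ] at h0
    rwa [integral_add iP3u i_ue] at h0
  -- for `e` (classically divergence free), slice by slice
  have hD_e : (∫ z : ℝ × E, φ z.1 z.2 * ⟪fderiv ℝ (e z.1) z.2 (e z.1 z.2), e z.1 z.2⟫) +
      ∫ z : ℝ × E, (1 / 2 : ℝ) * ‖e z.1 z.2‖ ^ 2 * ⟪e z.1 z.2, gradient (φ z.1) z.2⟫ = 0 := by
    have i_ee : Integrable (fun z : ℝ × E => (1 / 2 : ℝ) * ‖e z.1 z.2‖ ^ 2 * ⟪e z.1 z.2, gradient (φ z.1) z.2⟫)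
        volume := hint ((continuous_const.mul (he_c.norm.pow 2)).mul (he_c.inner hgφ_c))
          fun z hz => by rw [hgφK z hz, inner_zero_right, mul_zero]
    have isum : Integrable (fun z : ℝ × E => φ z.1 z.2 * ⟪fderiv ℝ (e z.1) z.2 (e z.1 z.2), e z.1 z.2⟫ +
        (1 / 2 : ℝ) * ‖e z.1 z.2‖ ^ 2 * ⟪e z.1 z.2, gradient (φ z.1) z.2⟫) volume := iD3.add i_ee
    rw [← integral_add iD3 i_ee, Measure.volume_eq_prod, integral_prod _ isum]
    refine integral_eq_zero_of_ae (Eventually.of_forall fun t => ?_)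
    dsimp only
    have hθ1 : ContDiff ℝ 1 fun y => φ t y * ((1 / 2 : ℝ) * ‖e t y‖ ^ 2) :=
      contDiff_infty.1 ((hθ.contDiff_slice t)) 1
    have key := integral_mul_divergence_add_eq_zero_left hθ1 (he1 t) ((hφ.hasCompactSupport_slice t).mul_right)
    simp only [hdiv t _, mul_zero, integral_zero, zero_add, hgradθ] at key
    exact key
  -- hence for `w`
  have hD2 : ∫ z : ℝ × E, φ z.1 z.2 * ⟪fderiv ℝ (e z.1) z.2 (u z.1 z.2 - e z.1 z.2), e z.1 z.2⟫ =
      -(1 / 2 : ℝ) * ∫ z : ℝ × E, ‖e z.1 z.2‖ ^ 2 * ⟪u z.1 z.2 - e z.1 z.2, gradient (φ z.1) z.2⟫ := by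
    have i_ee : Integrable (fun z : ℝ × E => (1 / 2 : ℝ) * ‖e z.1 z.2‖ ^ 2 * ⟪e z.1 z.2, gradient (φ z.1) z.2⟫)
        volume := hint ((continuous_const.mul (he_c.norm.pow 2)).mul (he_c.inner hgφ_c))
          fun z hz => by rw [hgφK z hz, inner_zero_right, mul_zero]
    have e1 : (fun z : ℝ × E => φ z.1 z.2 * ⟪fderiv ℝ (e z.1) z.2 (u z.1 z.2 - e z.1 z.2), e z.1 z.2⟫) =
        fun z : ℝ × E => φ z.1 z.2 * ⟪fderiv ℝ (e z.1) z.2 (u z.1 z.2), e z.1 z.2⟫ -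
          φ z.1 z.2 * ⟪fderiv ℝ (e z.1) z.2 (e z.1 z.2), e z.1 z.2⟫ := by
      funext z; rw [map_sub, inner_sub_left]; ring
    have e2 : (fun z : ℝ × E => ‖e z.1 z.2‖ ^ 2 * ⟪u z.1 z.2 - e z.1 z.2, gradient (φ z.1) z.2⟫) =
        fun z : ℝ × E => 2 * ((1 / 2 : ℝ) * ‖e z.1 z.2‖ ^ 2 * ⟪u z.1 z.2, gradient (φ z.1) z.2⟫) -
          2 * ((1 / 2 : ℝ) * ‖e z.1 z.2‖ ^ 2 * ⟪e z.1 z.2, gradient (φ z.1) z.2⟫) := by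
      funext z; rw [inner_sub_left]; ring
    rw [e1, e2, integral_sub iP3u iD3, integral_sub (i_ue.const_mul 2) (i_ee.const_mul 2),
      integral_const_mul, integral_const_mul]
    linarith
  have hD3 : ∫ z : ℝ × E, φ z.1 z.2 * ⟪fderiv ℝ (e z.1) z.2 (e z.1 z.2), e z.1 z.2⟫ =
      -(1 / 2 : ℝ) * ∫ z : ℝ × E, ⟪e z.1 z.2, gradient (φ z.1) z.2⟫ * ‖e z.1 z.2‖ ^ 2 := by
    have i_ee : Integrable (fun z : ℝ × E => (1 / 2 : ℝ) * ‖e z.1 z.2‖ ^ 2 * ⟪e z.1 z.2, gradient (φ z.1) z.2⟫)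
        volume := hint ((continuous_const.mul (he_c.norm.pow 2)).mul (he_c.inner hgφ_c))
          fun z hz => by rw [hgφK z hz, inner_zero_right, mul_zero]
    have e2 : (fun z : ℝ × E => ⟪e z.1 z.2, gradient (φ z.1) z.2⟫ * ‖e z.1 z.2‖ ^ 2) =
        fun z : ℝ × E => 2 * ((1 / 2 : ℝ) * ‖e z.1 z.2‖ ^ 2 * ⟪e z.1 z.2, gradient (φ z.1) z.2⟫) := by
      funext z; ring
    rw [e2, integral_const_mul]
    linarith
  -- ### (iii') weak divergence-freeness tested with `θ = φ π`
  have hθπ : IsSpaceTimeTestOn Ω fun t x => φ t x * π t x := hφ.mul_smooth hπ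
  have hπd : ∀ t x, DifferentiableAt ℝ (π t) x := fun t x =>
    ((contDiff_slice_of_uncurry hπ t).differentiable (by simp)) x
  have hgradθπ : ∀ t x (v : E), ⟪v, gradient (fun y => φ t y * π t y) x⟫ =
      π t x * ⟪v, gradient (φ t) x⟫ + φ t x * ⟪v, gradient (π t) x⟫ := by
    intro t x v
    rw [real_inner_comm, gradient, InnerProductSpace.toDual_symm_apply, fderiv_fun_mul (hφd t x) (hπd t x)]
    simp only [_root_.add_apply, _root_.FunLike.coe_smul, Pi.smul_apply, smul_eq_mul]
    rw [real_inner_comm (gradient (φ t) x), gradient, InnerProductSpace.toDual_symm_apply,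
      real_inner_comm (gradient (π t) x), gradient, InnerProductSpace.toDual_symm_apply]
    ring
  obtain ⟨Cπ, hCπ0, hCπ⟩ := exists_forall_mem_norm_le_of_continuous hKc hπ_c
  obtain ⟨Cgπ, hCgπ0, hCgπ⟩ := exists_forall_mem_norm_le_of_continuous hKc hgπ_c
  have i_πu : Integrable (fun z : ℝ × E => π z.1 z.2 * ⟪u z.1 z.2, gradient (φ z.1) z.2⟫) volume := by
    refine integrable_of_bound_on_compact hKc (gU1.const_mul (Cπ * Cgφ))
      (hπ_c.aestronglyMeasurable.mul (hum'.inner hgφ_c.aestronglyMeasurable))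
      (fun z hz => by rw [hgφK z hz, inner_zero_right, mul_zero]) fun z hz => ?_
    rw [norm_mul]
    calc ‖π z.1 z.2‖ * ‖⟪u z.1 z.2, gradient (φ z.1) z.2⟫‖ ≤ Cπ * (‖u z.1 z.2‖ * Cgφ) :=
          mul_le_mul (hCπ z hz) ((norm_inner_le_norm _ _).trans
            (mul_le_mul_of_nonneg_left (hCgφ z hz) (norm_nonneg _))) (norm_nonneg _) hCπ0
      _ = Cπ * Cgφ * ‖u z.1 z.2‖ := by ring
  have i_φuπ : Integrable (fun z : ℝ × E => φ z.1 z.2 * ⟪u z.1 z.2, gradient (π z.1) z.2⟫) volume := by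
    refine integrable_of_bound_on_compact hKc (gU1.const_mul (Cφ * Cgπ))
      (hφ_c.aestronglyMeasurable.mul (hum'.inner hgπ_c.aestronglyMeasurable))
      (fun z hz => by rw [hφK z hz, zero_mul]) fun z hz => ?_
    rw [norm_mul]
    calc ‖φ z.1 z.2‖ * ‖⟪u z.1 z.2, gradient (π z.1) z.2⟫‖ ≤ Cφ * (‖u z.1 z.2‖ * Cgπ) :=
          mul_le_mul (hCφ z hz) ((norm_inner_le_norm _ _).trans
            (mul_le_mul_of_nonneg_left (hCgπ z hz) (norm_nonneg _))) (norm_nonneg _) hCφ0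
      _ = Cφ * Cgπ * ‖u z.1 z.2‖ := by ring
  have hPi_u : (∫ z : ℝ × E, π z.1 z.2 * ⟪u z.1 z.2, gradient (φ z.1) z.2⟫) +
      ∫ z : ℝ × E, φ z.1 z.2 * ⟪u z.1 z.2, gradient (π z.1) z.2⟫ = 0 := by
    have h0 := hNS.2.2.2.1 _ hθπ
    rw [setIntegral_eq_integral_of_forall_compl_eq_zero (fun z hz => by
      have hzK : z ∉ K := fun h => hz (hKΩ h)
      rw [hgradθπ, hφK z hzK, hgφK z hzK, inner_zero_right, zero_mul, mul_zero, add_zero])] at h0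
    simp only [hgradθπ] at h0
    rwa [integral_add i_πu i_φuπ] at h0
  have hPi_e : (∫ z : ℝ × E, π z.1 z.2 * ⟪e z.1 z.2, gradient (φ z.1) z.2⟫) +
      ∫ z : ℝ × E, φ z.1 z.2 * ⟪e z.1 z.2, gradient (π z.1) z.2⟫ = 0 := by
    have i1 : Integrable (fun z : ℝ × E => π z.1 z.2 * ⟪e z.1 z.2, gradient (φ z.1) z.2⟫) volume :=
      hint (hπ_c.mul (he_c.inner hgφ_c)) fun z hz => by rw [hgφK z hz, inner_zero_right, mul_zero]
    have i2 : Integrable (fun z : ℝ × E => φ z.1 z.2 * ⟪e z.1 z.2, gradient (π z.1) z.2⟫) volume :=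
      hint (hφ_c.mul (he_c.inner hgπ_c)) fun z hz => by rw [hφK z hz, zero_mul]
    have isum : Integrable (fun z : ℝ × E => π z.1 z.2 * ⟪e z.1 z.2, gradient (φ z.1) z.2⟫ +
        φ z.1 z.2 * ⟪e z.1 z.2, gradient (π z.1) z.2⟫) volume := i1.add i2
    rw [← integral_add i1 i2, Measure.volume_eq_prod, integral_prod _ isum]
    refine integral_eq_zero_of_ae (Eventually.of_forall fun t => ?_)
    dsimp only
    have hθ1 : ContDiff ℝ 1 fun y => φ t y * π t y := contDiff_infty.1 ((hθπ.contDiff_slice t)) 1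
    have key := integral_mul_divergence_add_eq_zero_left hθ1 (he1 t) ((hφ.hasCompactSupport_slice t).mul_right)
    simp only [hdiv t _, mul_zero, integral_zero, zero_add, hgradθπ] at key
    exact key
  -- hence `∫∫ φ⟪w, ∇π⟫ = -∫∫ π w·∇φ`
  have i_πw : Integrable (fun z : ℝ × E => π z.1 z.2 * ⟪u z.1 z.2 - e z.1 z.2, gradient (φ z.1) z.2⟫) volume := by
    have i1 : Integrable (fun z : ℝ × E => π z.1 z.2 * ⟪e z.1 z.2, gradient (φ z.1) z.2⟫) volume :=
      hint (hπ_c.mul (he_c.inner hgφ_c)) fun z hz => by rw [hgφK z hz, inner_zero_right, mul_zero]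
    refine (i_πu.sub i1).congr (Eventually.of_forall fun z => ?_)
    simp only [Pi.sub_apply, inner_sub_left]
    ring
  have i_φwπ : Integrable (fun z : ℝ × E => φ z.1 z.2 * ⟪u z.1 z.2 - e z.1 z.2, gradient (π z.1) z.2⟫) volume := by
    have i2 : Integrable (fun z : ℝ × E => φ z.1 z.2 * ⟪e z.1 z.2, gradient (π z.1) z.2⟫) volume :=
      hint (hφ_c.mul (he_c.inner hgπ_c)) fun z hz => by rw [hφK z hz, zero_mul]
    refine (i_φuπ.sub i2).congr (Eventually.of_forall fun z => ?_)
    simp only [Pi.sub_apply, inner_sub_left]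
    ring
  have hPi : ∫ z : ℝ × E, φ z.1 z.2 * ⟪u z.1 z.2 - e z.1 z.2, gradient (π z.1) z.2⟫ =
      -∫ z : ℝ × E, π z.1 z.2 * ⟪u z.1 z.2 - e z.1 z.2, gradient (φ z.1) z.2⟫ := by
    have i1 : Integrable (fun z : ℝ × E => π z.1 z.2 * ⟪e z.1 z.2, gradient (φ z.1) z.2⟫) volume :=
      hint (hπ_c.mul (he_c.inner hgφ_c)) fun z hz => by rw [hgφK z hz, inner_zero_right, mul_zero]
    have i2 : Integrable (fun z : ℝ × E => φ z.1 z.2 * ⟪e z.1 z.2, gradient (π z.1) z.2⟫) volume :=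
      hint (hφ_c.mul (he_c.inner hgπ_c)) fun z hz => by rw [hφK z hz, zero_mul]
    have e1 : (fun z : ℝ × E => φ z.1 z.2 * ⟪u z.1 z.2 - e z.1 z.2, gradient (π z.1) z.2⟫) =
        fun z : ℝ × E => φ z.1 z.2 * ⟪u z.1 z.2, gradient (π z.1) z.2⟫ -
          φ z.1 z.2 * ⟪e z.1 z.2, gradient (π z.1) z.2⟫ := by
      funext z; rw [inner_sub_left]; ring
    have e2 : (fun z : ℝ × E => π z.1 z.2 * ⟪u z.1 z.2 - e z.1 z.2, gradient (φ z.1) z.2⟫) =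
        fun z : ℝ × E => π z.1 z.2 * ⟪u z.1 z.2, gradient (φ z.1) z.2⟫ -
          π z.1 z.2 * ⟪e z.1 z.2, gradient (φ z.1) z.2⟫ := by
      funext z; rw [inner_sub_left]; ring
    rw [e1, e2, integral_sub i_φuπ i2, integral_sub i_πu i1]
    linarith
  -- ### (iv') the forcing term `∫∫ φ⟪w, g⟫ = -∫∫ φ⟪De(e), w⟫ - ∫∫ φ⟪w, ∇π⟫`
  have hF_pt : ∀ z : ℝ × E, φ z.1 z.2 * ⟪u z.1 z.2 - e z.1 z.2, g z.1 z.2⟫ =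
      -(φ z.1 z.2 * ⟪fderiv ℝ (e z.1) z.2 (e z.1 z.2), u z.1 z.2 - e z.1 z.2⟫) -
        φ z.1 z.2 * ⟪u z.1 z.2 - e z.1 z.2, gradient (π z.1) z.2⟫ := by
    intro z
    simp only [hg_def, inner_sub_right, inner_neg_right,
      real_inner_comm (fderiv ℝ (e z.1) z.2 (e z.1 z.2)) (u z.1 z.2 - e z.1 z.2)]
    ring
  have iT2n : Integrable (fun z : ℝ × E =>
      -(φ z.1 z.2 * ⟪fderiv ℝ (e z.1) z.2 (e z.1 z.2), u z.1 z.2 - e z.1 z.2⟫)) volume := iT2.neg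
  have iF : Integrable (fun z : ℝ × E => φ z.1 z.2 * ⟪u z.1 z.2 - e z.1 z.2, g z.1 z.2⟫) volume :=
    (iT2n.sub i_φwπ).congr (Eventually.of_forall fun z => (hF_pt z).symm)
  have hF : ∫ t, ∫ x, φ t x * ⟪u t x - e t x, g t x⟫ =
      -(∫ z : ℝ × E, φ z.1 z.2 * ⟪fderiv ℝ (e z.1) z.2 (e z.1 z.2), u z.1 z.2 - e z.1 z.2⟫) -
        ∫ z : ℝ × E, φ z.1 z.2 * ⟪u z.1 z.2 - e z.1 z.2, gradient (π z.1) z.2⟫ := by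
    rw [← integral_prod (μ := volume) (ν := volume) _ iF]
    change ∫ z : ℝ × E, φ z.1 z.2 * ⟪u z.1 z.2 - e z.1 z.2, g z.1 z.2⟫ = _
    rw [funext hF_pt, integral_sub iT2n i_φwπ, integral_neg]
  -- ### (v') the transport, pressure and stretching terms in product form
  have gW1 : IntegrableOn (fun z : ℝ × E => ‖u z.1 z.2 - e z.1 z.2‖) K volume :=
    Integrable.mono' (gU1.add (integrableOn_const (C := Ce) (hs := hKc.measure_lt_top.ne)
      |>.integrable)) hwm'.norm ((ae_restrict_iff' hKm).2 (Eventually.of_forall fun z hz => by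
        rw [norm_norm]; exact (norm_sub_le _ _).trans (add_le_add le_rfl (hCe z hz))))
  have i_e2w : Integrable (fun z : ℝ × E => ‖e z.1 z.2‖ ^ 2 * ⟪u z.1 z.2 - e z.1 z.2, gradient (φ z.1) z.2⟫)
      volume := by
    refine integrable_of_bound_on_compact hKc (gW1.const_mul (Ce ^ 2 * Cgφ))
      ((he_c.norm.pow 2).aestronglyMeasurable.mul (hwm'.inner hgφ_c.aestronglyMeasurable))
      (fun z hz => by rw [hgφK z hz, inner_zero_right, mul_zero]) fun z hz => ?_
    rw [norm_mul, Real.norm_eq_abs, abs_of_nonneg (sq_nonneg _)]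
    calc ‖e z.1 z.2‖ ^ 2 * ‖⟪u z.1 z.2 - e z.1 z.2, gradient (φ z.1) z.2⟫‖
        ≤ Ce ^ 2 * (‖u z.1 z.2 - e z.1 z.2‖ * Cgφ) :=
          mul_le_mul (pow_le_pow_left₀ (norm_nonneg _) (hCe z hz) 2) ((norm_inner_le_norm _ _).trans
            (mul_le_mul_of_nonneg_left (hCgφ z hz) (norm_nonneg _))) (norm_nonneg _) (by positivity)
      _ = Ce ^ 2 * Cgφ * ‖u z.1 z.2 - e z.1 z.2‖ := by ring
  have i_ege2 : Integrable (fun z : ℝ × E => ⟪e z.1 z.2, gradient (φ z.1) z.2⟫ * ‖e z.1 z.2‖ ^ 2) volume :=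
    hint ((he_c.inner hgφ_c).mul (he_c.norm.pow 2)) fun z hz => by rw [hgφK z hz, inner_zero_right, zero_mul]
  -- `|w|² u·∇φ`
  have i_w2u : Integrable (fun z : ℝ × E => ‖u z.1 z.2 - e z.1 z.2‖ ^ 2 * ⟪u z.1 z.2, gradient (φ z.1) z.2⟫)
      volume := by
    refine integrable_of_bound_on_compact hKc (((gU3.const_mul 2).add (gU1.const_mul (2 * Ce ^ 2))).mul_const Cgφ)
      ((hwm'.norm.pow 2).mul (hum'.inner hgφ_c.aestronglyMeasurable))
      (fun z hz => by rw [hgφK z hz, inner_zero_right, mul_zero]) fun z hz => ?_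
    rw [norm_mul, Real.norm_eq_abs, abs_of_nonneg (sq_nonneg _)]
    have hw2 : ‖u z.1 z.2 - e z.1 z.2‖ ^ 2 ≤ 2 * ‖u z.1 z.2‖ ^ 2 + 2 * Ce ^ 2 := by
      calc ‖u z.1 z.2 - e z.1 z.2‖ ^ 2 ≤ (‖u z.1 z.2‖ + ‖e z.1 z.2‖) ^ 2 := by
            gcongr; exact norm_sub_le _ _
        _ ≤ 2 * ‖u z.1 z.2‖ ^ 2 + 2 * ‖e z.1 z.2‖ ^ 2 := by nlinarith [sq_nonneg (‖u z.1 z.2‖ - ‖e z.1 z.2‖)]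
        _ ≤ 2 * ‖u z.1 z.2‖ ^ 2 + 2 * Ce ^ 2 := by
            have := hCe z hz
            nlinarith [norm_nonneg (e z.1 z.2)]
    calc ‖u z.1 z.2 - e z.1 z.2‖ ^ 2 * ‖⟪u z.1 z.2, gradient (φ z.1) z.2⟫‖
        ≤ (2 * ‖u z.1 z.2‖ ^ 2 + 2 * Ce ^ 2) * (‖u z.1 z.2‖ * Cgφ) :=
          mul_le_mul hw2 ((norm_inner_le_norm _ _).trans
            (mul_le_mul_of_nonneg_left (hCgφ z hz) (norm_nonneg _))) (norm_nonneg _) (by positivity)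
      _ = (2 * ‖u z.1 z.2‖ ^ 3 + 2 * Ce ^ 2 * ‖u z.1 z.2‖) * Cgφ := by ring
  have hT_pt : ∀ z : ℝ × E, (‖u z.1 z.2 - e z.1 z.2‖ ^ 2 - ‖e z.1 z.2‖ ^ 2) * ⟪u z.1 z.2, gradient (φ z.1) z.2⟫ =
      ‖u z.1 z.2 - e z.1 z.2‖ ^ 2 * ⟪u z.1 z.2, gradient (φ z.1) z.2⟫ -
        (‖e z.1 z.2‖ ^ 2 * ⟪u z.1 z.2 - e z.1 z.2, gradient (φ z.1) z.2⟫ +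
          ⟪e z.1 z.2, gradient (φ z.1) z.2⟫ * ‖e z.1 z.2‖ ^ 2) := by
    intro z
    have h1 : ⟪u z.1 z.2, gradient (φ z.1) z.2⟫ =
        ⟪u z.1 z.2 - e z.1 z.2, gradient (φ z.1) z.2⟫ + ⟪e z.1 z.2, gradient (φ z.1) z.2⟫ := by
      rw [inner_sub_left]; ring
    linear_combination (-‖e z.1 z.2‖ ^ 2) * h1
  have i_e23 : Integrable (fun z : ℝ × E =>
      ‖e z.1 z.2‖ ^ 2 * ⟪u z.1 z.2 - e z.1 z.2, gradient (φ z.1) z.2⟫ +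
        ⟪e z.1 z.2, gradient (φ z.1) z.2⟫ * ‖e z.1 z.2‖ ^ 2) volume := i_e2w.add i_ege2
  have iTT : Integrable (fun z : ℝ × E => (‖u z.1 z.2 - e z.1 z.2‖ ^ 2 - ‖e z.1 z.2‖ ^ 2) *
      ⟪u z.1 z.2, gradient (φ z.1) z.2⟫) volume :=
    (i_w2u.sub i_e23).congr (Eventually.of_forall fun z => (hT_pt z).symm)
  have cT : ∫ t, ∫ x, (‖u t x - e t x‖ ^ 2 - ‖e t x‖ ^ 2) * ⟪u t x, gradient (φ t) x⟫ =
      (∫ z : ℝ × E, ‖u z.1 z.2 - e z.1 z.2‖ ^ 2 * ⟪u z.1 z.2, gradient (φ z.1) z.2⟫) -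
        ((∫ z : ℝ × E, ‖e z.1 z.2‖ ^ 2 * ⟪u z.1 z.2 - e z.1 z.2, gradient (φ z.1) z.2⟫) +
          ∫ z : ℝ × E, ⟪e z.1 z.2, gradient (φ z.1) z.2⟫ * ‖e z.1 z.2‖ ^ 2) := by
    rw [← integral_prod (μ := volume) (ν := volume) _ iTT]
    change ∫ z : ℝ × E, (‖u z.1 z.2 - e z.1 z.2‖ ^ 2 - ‖e z.1 z.2‖ ^ 2) * ⟪u z.1 z.2, gradient (φ z.1) z.2⟫ = _
    rw [funext hT_pt, integral_sub i_w2u i_e23, integral_add i_e2w i_ege2]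
  have cB : ∫ t, ∫ x, ‖u t x - e t x‖ ^ 2 * ⟪u t x, gradient (φ t) x⟫ =
      ∫ z : ℝ × E, ‖u z.1 z.2 - e z.1 z.2‖ ^ 2 * ⟪u z.1 z.2, gradient (φ z.1) z.2⟫ :=
    (integral_prod (μ := volume) (ν := volume) _ i_w2u).symm
  -- the pressures
  have i_pw : Integrable (fun z : ℝ × E => p z.1 z.2 * ⟪u z.1 z.2 - e z.1 z.2, gradient (φ z.1) z.2⟫) volume := by
    refine integrable_of_bound_on_compact hKc ((gPU.add (gP1.mul_const Ce)).mul_const Cgφ)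
      (hpm'.mul (hwm'.inner hgφ_c.aestronglyMeasurable))
      (fun z hz => by rw [hgφK z hz, inner_zero_right, mul_zero]) fun z hz => ?_
    rw [norm_mul]
    calc ‖p z.1 z.2‖ * ‖⟪u z.1 z.2 - e z.1 z.2, gradient (φ z.1) z.2⟫‖
        ≤ ‖p z.1 z.2‖ * ((‖u z.1 z.2‖ + Ce) * Cgφ) := by
          refine mul_le_mul_of_nonneg_left ((norm_inner_le_norm _ _).trans (mul_le_mul
            ((norm_sub_le _ _).trans (add_le_add le_rfl (hCe z hz))) (hCgφ z hz) (norm_nonneg _)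
            (by positivity))) (norm_nonneg _)
      _ = (‖p z.1 z.2‖ * ‖u z.1 z.2‖ + ‖p z.1 z.2‖ * Ce) * Cgφ := by ring
  have cP : ∫ t, ∫ x, p t x * ⟪u t x - e t x, gradient (φ t) x⟫ =
      ∫ z : ℝ × E, p z.1 z.2 * ⟪u z.1 z.2 - e z.1 z.2, gradient (φ z.1) z.2⟫ :=
    (integral_prod (μ := volume) (ν := volume) _ i_pw).symm
  have hQ_pt : ∀ z : ℝ × E, (p z.1 z.2 - π z.1 z.2) * ⟪u z.1 z.2 - e z.1 z.2, gradient (φ z.1) z.2⟫ =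
      p z.1 z.2 * ⟪u z.1 z.2 - e z.1 z.2, gradient (φ z.1) z.2⟫ -
        π z.1 z.2 * ⟪u z.1 z.2 - e z.1 z.2, gradient (φ z.1) z.2⟫ := fun z => by ring
  have iQ : Integrable (fun z : ℝ × E => (p z.1 z.2 - π z.1 z.2) * ⟪u z.1 z.2 - e z.1 z.2, gradient (φ z.1) z.2⟫)
      volume := (i_pw.sub i_πw).congr (Eventually.of_forall fun z => (hQ_pt z).symm)
  have cQ : ∫ t, ∫ x, (p t x - π t x) * ⟪u t x - e t x, gradient (φ t) x⟫ =
      (∫ z : ℝ × E, p z.1 z.2 * ⟪u z.1 z.2 - e z.1 z.2, gradient (φ z.1) z.2⟫) -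
        ∫ z : ℝ × E, π z.1 z.2 * ⟪u z.1 z.2 - e z.1 z.2, gradient (φ z.1) z.2⟫ := by
    rw [← integral_prod (μ := volume) (ν := volume) _ iQ]
    change ∫ z : ℝ × E, (p z.1 z.2 - π z.1 z.2) * ⟪u z.1 z.2 - e z.1 z.2, gradient (φ z.1) z.2⟫ = _
    rw [funext hQ_pt, integral_sub i_pw i_πw]
  -- the stretching term
  have cS : ∫ t, ∫ x, φ t x * ⟪fderiv ℝ (e t) x (u t x - e t x), u t x - e t x⟫ =
      ∫ z : ℝ × E, φ z.1 z.2 * ⟪fderiv ℝ (e z.1) z.2 (u z.1 z.2 - e z.1 z.2), u z.1 z.2 - e z.1 z.2⟫ :=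
    (integral_prod (μ := volume) (ν := volume) _ iT1).symm
  -- ### conclusion
  rw [cB, cQ, cS]
  rw [cT, cP, hP3, hF, hPi] at h4
  linarith [h4, hD2, hD3]

end Main

end JiaSverak2014

end Literature.Analysis.FluidPDE

end
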